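import Literature.AlgebraicGeometry.Kloosterman2025.ExceptionalSetConeDescent
import HarnessLib

/-!
# Kloosterman 2025, Theorem 1.2 / Theorem 4.9: the counterexamples to Movasati's conjecture

R. Kloosterman, *On a conjecture on Hodge loci of linear combinations of linear subvarieties*, Rend. Circ. Mat.
Palermo (2) 74 (2025) = arXiv:2312.12363 [cite: Kloosterman2025]. Movasati conjectured ([Klo25, Conjecture 1.1]:
"Let `k ≥ 2` … `X` a hypersurface of degree `3` in `ℙ^{2k+1}` containing two `k`-planes such that their intersection
has dimension `k−3` … `gcd(a,b)=1`, `ab ≠ 0`, then `codim NL(a[Π₁]+b[Π₂]) = codim NL([Π₁],[Π₂]) − 1`", and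
"a similar result for `d = 4`, `m = k−2`") that the Hodge locus of a combination is strictly bigger than
`NL([Π₁],[Π₂])`. Kloosterman disproves this for large `k`:

> **Theorem 1.2.** Suppose `d=3, c ∈ {2,3}, k ≥ 5` or `d=4, c=2, k ≥ 3`. Then there exists a smooth hypersurface
> `X ⊂ ℙ^{2k+1}` of degree `d` containing two `k`-planes intersecting in codimension `c` and a finite set `S`, such
> that for all `λ ∈ ℚ ∖ S` we have `codim T_X NL([Π₁]+λ[Π₂]) = codim T_X NL([Π₁],[Π₂])`. In particular,
> `NL([Π₁]+λ[Π₂]) = NL([Π₁],[Π₂])` in a neighborhood of `X`.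

> **Theorem 4.9.** (same hypotheses) … such that for almost all `λ ∈ ℚ` we have `codim T_X NL([Π₁]+λ[Π₂]) =
> codim T_X NL([Π₁],[Π₂])` … Moreover, if `(c−1)(d−2) = 2` then there is at most one nonzero `λ ∈ ℚ` such that
> `NL([Π₁]+λ[Π₂]) ≠ NL([Π₁],[Π₂])` in a neighborhood of `X`.

> Proof of 4.9: "The base case for the induction follows from Examples 4.3 through 4.5, whereas the induction step
> is Proposition 4.7 … In particular the number of `λ`, where the rank drops, does not increase."

## What is proved (sorry-free), and how — §§1–4 in the companion file `ExceptionalSetConeDescent.lean`, §§5–7 here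

Everything is stated in the algebraic language of [Klo25, §§2–3] already in the tree
(`ExcessTangentDimensionLowerBound.lean`, `PencilOfPairingsGenericMember.lean`, `ArtinianGorensteinOfFunctional.lean`):
a hypersurface in Kloosterman's normal form `F = twoPlanesForm gA h gC Q P = Σ g_i h_j Q_{ij} + Σ g'_m P_m`, a socle
functional `ℓ` of its Jacobian ideal (`annIdeal ℓ = J^F`, Construction 3.1), the two cycle functionals
`ℓ_j = ciCycleFunctional ℓ (plane_jGens) (plane_jCofs)` with `I(ℓ_j) = I(Π_j)` (Example 3.5), and the pencil
`ℓ₁ + cℓ₂` (`c = ν(λ)`, Lemma 3.12). The EXCEPTIONAL SET `excessSet ℓ₁ ℓ₂ a = {c ≠ 0 : (I₁ ∩ I₂)_a ⊊ I(ℓ₁+cℓ₂)_a}`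
is Kloosterman's finite set of `λ` (in degree `a = d`: positive excess of `T_X NL([Π₁]+λ[Π₂])` over `T_X NL([Π₁],[Π₂])`).

* §1 `colonCriterion_*`, `excessSet_finite_of_colon`, `ncard_excessSet_le_of_colon`: Theorem 3.13 with its
  hypothesis ("the left kernel of `(I₁+I₂/I₂)_d × (I₁+I₂/I₂)_{kd−2k−2} → (S/I₂)_{(k+1)(d−2)}` is zero") in ideal
  form — every `v ∈ (I₁)_a` with `vI₁ ⊆ I₂` lies in `I₂` — giving `E_a` finite with `#E_a ≤ h_{I₁+I₂}(a)`; the degree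
  shift of the proof of 4.9 (`colonCriterion_of_le`); Lemma 2.9 (`excessSet_eq_empty_of_hilbert_eq_zero`); and a
  SUFFICIENT CONDITION `colonCriterion_of_forall_mem_sup_colon`: `S_{t−a} ⊆ I₁ + (I₂ : I₁)`.
* §2 invariance of `E_a` under rescaling the functionals and relabelling variables; §2bis (JOIN DESCENT,
  `excessSet_tensorFunctional_subset`): for ANY third functional `ℓ_C` on new variables,
  `E_a(ℓ₁ ⊗ ℓ_C, ℓ₂ ⊗ ℓ_C) ⊆ ⋃_{a' ≤ a} E_{a'}(ℓ₁, ℓ₂)` — the mechanism of Proposition 4.7 (the cone's cycle ideals are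
  the joins `Ĩ_j = S̃ I_j + ⟨y^{d−1}, z⟩`, and a witness of excess for the join contracts against `ℓ_C` to a witness
  for the base in some degree `a' ≤ a`).
* §3 the `m`-fold cone `f̃` of a normal form (`coneGA, coneGC, coneQ, coneP`; `twoPlanesForm_cone`:
  `f̃ = f + Σ_i z_i(z_i^{d−1} + y_i^{d−1})`), its smoothness from that of `f` (`exists_X_pow_mem_jacobianIdeal_cone`),
  and the identification of the cone's cycle ideals with the relabelled joins (`annIdeal_cone_plane₁_eq_map`, by one
  inclusion and Artinian–Gorenstein rigidity); whence `excessSet_cone`: (1) `E_{a'}(base)` finite for `a' ≤ a` ⇒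
  `E_a(cone)` finite; (2) if moreover `E_{a'}(base) = ∅` for `a' < a` then `#E_a(cone) ≤ #E_a(base)` — for ALL `m` at
  once (the tree's form of "the number of `λ` where the rank drops does not increase").
* §5, §6 the bases: Example 4.3 (`d=4,c=2,k=3`, `ℙ⁷`) and Example 4.4 (`d=3,c=3,k=5`, `ℙ¹¹`) with the printed `Q, P`.
  Smoothness ("`X = V(f)` is smooth") is certified by explicit identities `D·x_l^N = Σ_u h_u ∂_u f` checked by `ring`
  (`ex43_X_pow_mem`, `ex44_X_pow_mem`). In place of the rank of the `18 × 18` Gram matrix ("full rank 18 and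
  therefore there is no left kernel"; "computer code, Appendix") the colon criterion is certified by ONE element:
  `u = (x_0²+x_4²)(x_1²+x_5²) ∈ (I₂ : I₁)` (resp. `u = (x_0+x_6)(x_1+x_7)(x_2+x_8)`), which together with the obvious
  members gives `S_4 ⊆ I₁ + (I₂:I₁)` (resp. `S_3 ⊆ …`) monomial by monomial (`ex43_monomial_mem`). Hence
  (`ex43_base`, `ex44_base`) for EVERY socle functional: `E_{a'}` finite (`a' ≤ d`), empty (`a' < d`, Lemma 2.9 as
  `h_{I₁+I₂}(b) = ciHilbert((d−1)^r)(b) = 0` for `b > (k+1−c)(d−2)`), and `#E_d ≤ h_{I₁+I₂}(d) = 1`.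
* §7 HEADLINES: `theorem_4_9_quartic` / `theorem_4_9_cubic` (every `m`, every indexing `κ`, every socle functional:
  `E_d` finite and `#E_d ≤ 1`), `…_almost_all` (a finite `E`, `#E ≤ 1`, and `I(ℓ₁+cℓ₂)_d = (I₁ ∩ I₂)_d` for all other
  `c ≠ 0`), `…_nonvacuous` (the cone is smooth and HAS a socle functional), and the existential
  `theorem_1_2_quartic (k ≥ 3)` / `theorem_1_2_cubic (k ≥ 5)` shaped like the printed theorems.

## What is NOT formalised here (scope, stated precisely)

* The `(d,c) = (3,2)` series (Example 4.5, the non-split `Q_{03} = 3x_3+x_5`, `Q_{12} = x_6+5x_7`): its base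
  certificate needs four independent colon elements; not attempted. Theorems 1.2/4.9 are proved here for
  `(d,c) ∈ {(4,2),(3,3)}` only (both series with `(c−1)(d−2) = 2`, i.e. WITH the "at most one `λ`" clause).
* The dictionary Lemma 3.6 / Lemma 3.12 / Proposition 3.9 (`I(ℓ₁+ν(λ)ℓ₂)_d / J_d = T_X NL([Π₁]+λ[Π₂])`, smoothness
  of `NL([Π₁],[Π₂])`, hence "`NL(…) = NL(…)` in a neighborhood") is Hodge theory not available in Mathlib; the file
  stops at the Gorenstein ideals, exactly as the tree's Theorem 1.3 file does. The identification `S = {0,−1}` /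
  `{0,1}` of Theorem 1.2's "Moreover" is §5 of the paper and is not touched.
* Ground field: any field of characteristic `0` (the paper works over `ℂ` with `λ ∈ ℚ`).

HONEST FRAMING (cell pub-hlocus): certified instances and evidence bearing on the general Hodge conjecture; no claim.

## References

* [Klo25] R. Kloosterman, arXiv:2312.12363, Rend. Circ. Mat. Palermo 74 (2025) — Thm 1.2, Lemma 2.9, Construction
  3.1, Example 3.5, Lemma 3.12, Thm 3.13, Examples 4.3–4.4, Prop 4.6, Prop 4.7, Thm 4.9. [cite: Kloosterman2025]
* [DFV25] J. Duque Franco, R. Villaflor Loyola, joins of Artinian Gorenstein ideals (tree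
  `DuqueFrancoVillaflor2025/JoinArtinianGorenstein.lean`). [cite: DuqueFrancoVillaflor2025Join]
-/

noncomputable section

open MvPolynomial Module Literature.RingTheory.MvPolynomial

attribute [local instance] MvPolynomial.gradedAlgebra

namespace Literature.AlgebraicGeometry.Kloosterman2025

/-! ## Section 5 — Example 4.3 (`d = 4`, `c = 2`, `k = 3`): the quartic sixfold

`f = Σ_{i=0}^{1} Σ_{j=2}^{3} x_i x_j Q_{ij} + Σ_{i=6}^{7} x_i P_i` with `Q_{02} = x_0²+x_2²+x_4²`, `Q_{13} = x_1²+x_3²+x_5²`,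
`Q_{03} = Q_{12} = 0`, `P_6 = x_4(x_4²+x_6²)`, `P_7 = x_5(x_5²+x_7²)`; `Π₁ = V(x_0,x_1,x_6,x_7)`, `Π₂ = V(x_2,x_3,x_6,x_7)`
(two `3`-planes in the quartic `X = V(f) ⊂ ℙ⁷` meeting in codimension `2`). In the tree's normal form
`twoPlanesForm gA h gC Q P`: `gA = (x_0,x_1)`, `h = (x_2,x_3)`, `gC = (x_6,x_7)`, `Q = diag(Q_{02},Q_{13})`, `P = (P_6,P_7)`. -/

section Example43

open Literature.AlgebraicGeometry.Motives.UniversalHypersurface Literature.AlgebraicGeometry.Kloosterman2023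

variable {K : Type*} [Field K]

/-- `gA = (x_0, x_1)` (Example 4.3). [cite: Kloosterman2025, Example 4.3] -/
def ex43GA : Fin 2 → MvPolynomial (Fin (2 * 3 + 2)) K := ![X 0, X 1]

/-- `h = (x_2, x_3)` (Example 4.3). [cite: Kloosterman2025, Example 4.3] -/
def ex43H : Fin 2 → MvPolynomial (Fin (2 * 3 + 2)) K := ![X 2, X 3]

/-- `gC = (x_6, x_7)` (Example 4.3). [cite: Kloosterman2025, Example 4.3] -/
def ex43GC : Fin 2 → MvPolynomial (Fin (2 * 3 + 2)) K := ![X 6, X 7]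

/-- `Q = diag(x_0²+x_2²+x_4², x_1²+x_3²+x_5²)`, `Q_{03} = Q_{12} = 0` (Example 4.3). [cite: Kloosterman2025, Example 4.3] -/
def ex43Q : Fin 2 → Fin 2 → MvPolynomial (Fin (2 * 3 + 2)) K :=
  ![![X 0 ^ 2 + X 2 ^ 2 + X 4 ^ 2, 0], ![0, X 1 ^ 2 + X 3 ^ 2 + X 5 ^ 2]]

/-- `P = (x_4(x_4²+x_6²), x_5(x_5²+x_7²))` (Example 4.3). [cite: Kloosterman2025, Example 4.3] -/
def ex43P : Fin 2 → MvPolynomial (Fin (2 * 3 + 2)) K := ![X 4 * (X 4 ^ 2 + X 6 ^ 2), X 5 * (X 5 ^ 2 + X 7 ^ 2)]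

local notation "S" => MvPolynomial (Fin (2 * 3 + 2)) K
local notation "x" n:max => (X n : MvPolynomial (Fin (2 * 3 + 2)) K)
local notation "F₄₃" => twoPlanesForm (ex43GA (K := K)) ex43H ex43GC ex43Q ex43P

/-- `gA_0 = x_0` (Example 4.3). [cite: Kloosterman2025, Example 4.3] -/
@[simp] theorem ex43GA_zero : ex43GA (K := K) 0 = X 0 := rfl
/-- `gA_1 = x_1` (Example 4.3). [cite: Kloosterman2025, Example 4.3] -/
@[simp] theorem ex43GA_one : ex43GA (K := K) 1 = X 1 := rfl
/-- `h_0 = x_2` (Example 4.3). [cite: Kloosterman2025, Example 4.3] -/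
@[simp] theorem ex43H_zero : ex43H (K := K) 0 = X 2 := rfl
/-- `h_1 = x_3` (Example 4.3). [cite: Kloosterman2025, Example 4.3] -/
@[simp] theorem ex43H_one : ex43H (K := K) 1 = X 3 := rfl
/-- `gC_0 = x_6` (Example 4.3). [cite: Kloosterman2025, Example 4.3] -/
@[simp] theorem ex43GC_zero : ex43GC (K := K) 0 = X 6 := rfl
/-- `gC_1 = x_7` (Example 4.3). [cite: Kloosterman2025, Example 4.3] -/
@[simp] theorem ex43GC_one : ex43GC (K := K) 1 = X 7 := rfl
/-- `Q_{02} = x_0²+x_2²+x_4²` (Example 4.3). [cite: Kloosterman2025, Example 4.3] -/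
@[simp] theorem ex43Q_zero_zero : ex43Q (K := K) 0 0 = X 0 ^ 2 + X 2 ^ 2 + X 4 ^ 2 := rfl
/-- `Q_{03} = 0` (Example 4.3). [cite: Kloosterman2025, Example 4.3] -/
@[simp] theorem ex43Q_zero_one : ex43Q (K := K) 0 1 = 0 := rfl
/-- `Q_{12} = 0` (Example 4.3). [cite: Kloosterman2025, Example 4.3] -/
@[simp] theorem ex43Q_one_zero : ex43Q (K := K) 1 0 = 0 := rfl
/-- `Q_{13} = x_1²+x_3²+x_5²` (Example 4.3). [cite: Kloosterman2025, Example 4.3] -/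
@[simp] theorem ex43Q_one_one : ex43Q (K := K) 1 1 = X 1 ^ 2 + X 3 ^ 2 + X 5 ^ 2 := rfl
/-- `P_6 = x_4(x_4²+x_6²)` (Example 4.3). [cite: Kloosterman2025, Example 4.3] -/
@[simp] theorem ex43P_zero : ex43P (K := K) 0 = X 4 * (X 4 ^ 2 + X 6 ^ 2) := rfl
/-- `P_7 = x_5(x_5²+x_7²)` (Example 4.3). [cite: Kloosterman2025, Example 4.3] -/
@[simp] theorem ex43P_one : ex43P (K := K) 1 = X 5 * (X 5 ^ 2 + X 7 ^ 2) := rfl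

/-- Example 4.3's `f`, written out. [cite: Kloosterman2025, Example 4.3] -/
theorem ex43Form_eq : F₄₃ =
    x 0 * x 2 * (x 0 ^ 2 + x 2 ^ 2 + x 4 ^ 2) + x 1 * x 3 * (x 1 ^ 2 + x 3 ^ 2 + x 5 ^ 2) +
      x 6 * (x 4 * (x 4 ^ 2 + x 6 ^ 2)) + x 7 * (x 5 * (x 5 ^ 2 + x 7 ^ 2)) := by
  simp only [twoPlanesForm, Fin.sum_univ_two, ex43GA_zero, ex43GA_one, ex43H_zero, ex43H_one, ex43GC_zero,
    ex43GC_one, ex43Q_zero_zero, ex43Q_zero_one, ex43Q_one_zero, ex43Q_one_one, ex43P_zero, ex43P_one]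
  ring

/-- The `g_i` are linear forms (Example 4.3). [cite: Kloosterman2025, Example 4.3] -/
theorem ex43_hgA : ∀ i, (ex43GA (K := K) i).IsHomogeneous 1 :=
  Fin.forall_fin_two.mpr ⟨isHomogeneous_X K 0, isHomogeneous_X K 1⟩

/-- The `h_j` are linear forms (Example 4.3). [cite: Kloosterman2025, Example 4.3] -/
theorem ex43_hh : ∀ j, (ex43H (K := K) j).IsHomogeneous 1 :=
  Fin.forall_fin_two.mpr ⟨isHomogeneous_X K 2, isHomogeneous_X K 3⟩

/-- The `g'_m` are linear forms (Example 4.3). [cite: Kloosterman2025, Example 4.3] -/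
theorem ex43_hgC : ∀ m, (ex43GC (K := K) m).IsHomogeneous 1 :=
  Fin.forall_fin_two.mpr ⟨isHomogeneous_X K 6, isHomogeneous_X K 7⟩

/-- The `Q_{ij}` are quadrics (`d − 2 = 2`) (Example 4.3). [cite: Kloosterman2025, Example 4.3] -/
theorem ex43_hQ : ∀ i j, (ex43Q (K := K) i j).IsHomogeneous (4 - 2) :=
  Fin.forall_fin_two.mpr
    ⟨Fin.forall_fin_two.mpr ⟨((isHomogeneous_X_pow 0 2).add (isHomogeneous_X_pow 2 2)).add (isHomogeneous_X_pow 4 2),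
      isHomogeneous_zero _ _ _⟩,
    Fin.forall_fin_two.mpr ⟨isHomogeneous_zero _ _ _,
      ((isHomogeneous_X_pow 1 2).add (isHomogeneous_X_pow 3 2)).add (isHomogeneous_X_pow 5 2)⟩⟩

/-- The `P_m` are cubics (`d − 1 = 3`) (Example 4.3). [cite: Kloosterman2025, Example 4.3] -/
theorem ex43_hP : ∀ m, (ex43P (K := K) m).IsHomogeneous (4 - 1) :=
  Fin.forall_fin_two.mpr
    ⟨(isHomogeneous_X K 4).mul ((isHomogeneous_X_pow 4 2).add (isHomogeneous_X_pow 6 2)),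
     (isHomogeneous_X K 5).mul ((isHomogeneous_X_pow 5 2).add (isHomogeneous_X_pow 7 2))⟩

/-- `Π₁ = V(x_0,x_1,x_6,x_7)` and `Π₂ = V(x_2,x_3,x_6,x_7)` are two `3`-planes of `ℙ^7` meeting in codimension `2`:
the six linear generators `gA, h, gC` are linearly independent. [cite: Kloosterman2025, Example 4.3] -/
theorem ex43_planes_linearIndependent :
    LinearIndependent K (Sum.elim (Sum.elim (ex43GA (K := K)) ex43H) ex43GC) :=
  linearIndependent_of_eq_X_comp (Sum.elim (Sum.elim ![0, 1] ![2, 3]) ![6, 7]) (by decide) _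
    (fun i => by rcases i with (i | i) | i <;> fin_cases i <;> rfl)

/-- `∂f/∂x_0`. [cite: Kloosterman2025, Example 4.3] -/
theorem ex43_pderiv_0 : pderiv 0 F₄₃ = (3 : S) * x 0 ^ 2 * x 2 + x 2 ^ 3 + x 2 * x 4 ^ 2 := by
  rw [ex43Form_eq]
  simp (config := { decide := true }) only [map_add, Derivation.leibniz, Derivation.leibniz_pow,
    pderiv_X, Pi.single_apply, if_true, if_false, smul_eq_mul, nsmul_eq_mul]
  ring

/-- `∂f/∂x_2`. [cite: Kloosterman2025, Example 4.3] -/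
theorem ex43_pderiv_2 : pderiv 2 F₄₃ = x 0 ^ 3 + (3 : S) * x 0 * x 2 ^ 2 + x 0 * x 4 ^ 2 := by
  rw [ex43Form_eq]
  simp (config := { decide := true }) only [map_add, Derivation.leibniz, Derivation.leibniz_pow,
    pderiv_X, Pi.single_apply, if_true, if_false, smul_eq_mul, nsmul_eq_mul]
  ring

/-- `∂f/∂x_4`. [cite: Kloosterman2025, Example 4.3] -/
theorem ex43_pderiv_4 : pderiv 4 F₄₃ = (2 : S) * x 0 * x 2 * x 4 + (3 : S) * x 4 ^ 2 * x 6 + x 6 ^ 3 := by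
  rw [ex43Form_eq]
  simp (config := { decide := true }) only [map_add, Derivation.leibniz, Derivation.leibniz_pow,
    pderiv_X, Pi.single_apply, if_true, if_false, smul_eq_mul, nsmul_eq_mul]
  ring

/-- `∂f/∂x_6`. [cite: Kloosterman2025, Example 4.3] -/
theorem ex43_pderiv_6 : pderiv 6 F₄₃ = x 4 ^ 3 + (3 : S) * x 4 * x 6 ^ 2 := by
  rw [ex43Form_eq]
  simp (config := { decide := true }) only [map_add, Derivation.leibniz, Derivation.leibniz_pow,
    pderiv_X, Pi.single_apply, if_true, if_false, smul_eq_mul, nsmul_eq_mul]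
  ring

/-- `∂f/∂x_1`. [cite: Kloosterman2025, Example 4.3] -/
theorem ex43_pderiv_1 : pderiv 1 F₄₃ = (3 : S) * x 1 ^ 2 * x 3 + x 3 ^ 3 + x 3 * x 5 ^ 2 := by
  rw [ex43Form_eq]
  simp (config := { decide := true }) only [map_add, Derivation.leibniz, Derivation.leibniz_pow,
    pderiv_X, Pi.single_apply, if_true, if_false, smul_eq_mul, nsmul_eq_mul]
  ring

/-- `∂f/∂x_3`. [cite: Kloosterman2025, Example 4.3] -/
theorem ex43_pderiv_3 : pderiv 3 F₄₃ = x 1 ^ 3 + (3 : S) * x 1 * x 3 ^ 2 + x 1 * x 5 ^ 2 := by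
  rw [ex43Form_eq]
  simp (config := { decide := true }) only [map_add, Derivation.leibniz, Derivation.leibniz_pow,
    pderiv_X, Pi.single_apply, if_true, if_false, smul_eq_mul, nsmul_eq_mul]
  ring

/-- `∂f/∂x_5`. [cite: Kloosterman2025, Example 4.3] -/
theorem ex43_pderiv_5 : pderiv 5 F₄₃ = (2 : S) * x 1 * x 3 * x 5 + (3 : S) * x 5 ^ 2 * x 7 + x 7 ^ 3 := by
  rw [ex43Form_eq]
  simp (config := { decide := true }) only [map_add, Derivation.leibniz, Derivation.leibniz_pow,
    pderiv_X, Pi.single_apply, if_true, if_false, smul_eq_mul, nsmul_eq_mul]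
  ring

/-- `∂f/∂x_7`. [cite: Kloosterman2025, Example 4.3] -/
theorem ex43_pderiv_7 : pderiv 7 F₄₃ = x 5 ^ 3 + (3 : S) * x 5 * x 7 ^ 2 := by
  rw [ex43Form_eq]
  simp (config := { decide := true }) only [map_add, Derivation.leibniz, Derivation.leibniz_pow,
    pderiv_X, Pi.single_apply, if_true, if_false, smul_eq_mul, nsmul_eq_mul]
  ring

/-- `x_0^9 ∈ J^F` (certificate `326016·x_0^9 = Σ h_u ∂_u F`, exact linear algebra). [cite: Kloosterman2025, Example 4.3 ("X = V(f) is smooth")] -/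
theorem ex43_X0_pow_mem [CharZero K] : (X 0 : S) ^ 9 ∈ jacobianIdeal F₄₃ := by
  refine mem_of_natCast_mul_mem 326016 (Nat.cast_ne_zero.mpr (by norm_num)) ?_
  have key : (326016 : S) * x 0 ^ 9 =
      ((-326016 : S) * x 0 ^ 5 * x 2 + (108672 : S) * x 0 ^ 3 * x 2 ^ 3 + (434688 : S) * x 0 ^ 3 * x 2 * x 4 ^ 2 + (-365472 : S) * x 0 ^ 2 * x 4 ^ 3 * x 6 + (-40752 : S) * x 0 * x 2 ^ 5 + (-207156 : S) * x 0 * x 2 ^ 3 * x 4 ^ 2 + (-543715 : S) * x 0 * x 2 * x 4 ^ 4 + (6819 : S) * x 0 * x 2 * x 4 ^ 2 * x 6 ^ 2 + (-26304 : S) * x 4 ^ 5 * x 6 + (-81504 : S) * x 4 ^ 3 * x 6 ^ 3) * pderiv 0 F₄₃ +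
      ((326016 : S) * x 0 ^ 6 + (-326016 : S) * x 0 ^ 4 * x 4 ^ 2 + (326016 : S) * x 0 ^ 2 * x 4 ^ 4 + (1096416 : S) * x 0 * x 2 * x 4 ^ 3 * x 6 + (13584 : S) * x 2 ^ 6 + (78108 : S) * x 2 ^ 4 * x 4 ^ 2 + (218409 : S) * x 2 ^ 2 * x 4 ^ 4 + (-20457 : S) * x 2 ^ 2 * x 4 ^ 2 * x 6 ^ 2 + (-326016 : S) * x 4 ^ 6) * pderiv 2 F₄₃ +
      ((-1461888 : S) * x 0 * x 2 ^ 2 * x 4 ^ 2 * x 6 + (-326016 : S) * x 0 * x 4 ^ 4 * x 6 + (122256 : S) * x 0 * x 4 ^ 2 * x 6 ^ 3 + (8768 : S) * x 2 ^ 3 * x 4 ^ 3 + (27276 : S) * x 2 ^ 3 * x 4 * x 6 ^ 2 + (651677 : S) * x 2 * x 4 ^ 5 + (2199651 : S) * x 2 * x 4 ^ 3 * x 6 ^ 2 + (730944 : S) * x 2 * x 4 * x 6 ^ 4) * pderiv 4 F₄₃ +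
      ((326016 : S) * x 0 * x 4 ^ 5 + (-40752 : S) * x 0 * x 4 * x 6 ^ 4 + (-9092 : S) * x 2 ^ 3 * x 6 ^ 3 + (-1928727 : S) * x 2 * x 4 ^ 4 * x 6 + (-1382945 : S) * x 2 * x 4 ^ 2 * x 6 ^ 3 + (-243648 : S) * x 2 * x 6 ^ 5) * pderiv 6 F₄₃ := by
    rw [ex43_pderiv_0, ex43_pderiv_2, ex43_pderiv_4, ex43_pderiv_6]
    ring
  rw [show (((326016 : ℕ) : S)) = (326016 : S) by norm_cast, key]
  exact Ideal.add_mem _ (Ideal.add_mem _ (Ideal.add_mem _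
    (Ideal.mul_mem_left _ _ (pderiv_mem_jacobianIdeal _ _))
    (Ideal.mul_mem_left _ _ (pderiv_mem_jacobianIdeal _ _)))
    (Ideal.mul_mem_left _ _ (pderiv_mem_jacobianIdeal _ _)))
    (Ideal.mul_mem_left _ _ (pderiv_mem_jacobianIdeal _ _))

/-- `x_2^9 ∈ J^F` (certificate `18112·x_2^9 = Σ h_u ∂_u F`, exact linear algebra). [cite: Kloosterman2025, Example 4.3 ("X = V(f) is smooth")] -/
theorem ex43_X2_pow_mem [CharZero K] : (X 2 : S) ^ 9 ∈ jacobianIdeal F₄₃ := by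
  refine mem_of_natCast_mul_mem 18112 (Nat.cast_ne_zero.mpr (by norm_num)) ?_
  have key : (18112 : S) * x 2 ^ 9 =
      ((6792 : S) * x 0 ^ 2 * x 2 ^ 4 + (-8490 : S) * x 0 ^ 2 * x 2 ^ 2 * x 4 ^ 2 + (8928 : S) * x 0 ^ 2 * x 4 ^ 4 + (6768 : S) * x 0 * x 2 * x 4 ^ 3 * x 6 + (18112 : S) * x 2 ^ 6 + (-18112 : S) * x 2 ^ 4 * x 4 ^ 2 + (18112 : S) * x 2 ^ 2 * x 4 ^ 4 + (5952 : S) * x 4 ^ 6) * pderiv 0 F₄₃ +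
      ((-20376 : S) * x 0 * x 2 ^ 5 + (25470 : S) * x 0 * x 2 ^ 3 * x 4 ^ 2 + (-26784 : S) * x 0 * x 2 * x 4 ^ 4 + (-20304 : S) * x 2 ^ 2 * x 4 ^ 3 * x 6) * pderiv 2 F₄₃ +
      ((54 : S) * x 0 * x 2 ^ 2 * x 4 ^ 3 + (27072 : S) * x 2 ^ 3 * x 4 ^ 2 * x 6 + (6687 : S) * x 2 * x 4 ^ 4 * x 6 + (-27 : S) * x 2 * x 4 ^ 2 * x 6 ^ 3) * pderiv 4 F₄₃ +
      ((-24064 : S) * x 2 ^ 3 * x 4 ^ 3 + (-9024 : S) * x 2 ^ 3 * x 4 * x 6 ^ 2 + (-5952 : S) * x 2 * x 4 ^ 5 + (-2205 : S) * x 2 * x 4 ^ 3 * x 6 ^ 2 + (9 : S) * x 2 * x 4 * x 6 ^ 4) * pderiv 6 F₄₃ := by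
    rw [ex43_pderiv_0, ex43_pderiv_2, ex43_pderiv_4, ex43_pderiv_6]
    ring
  rw [show (((18112 : ℕ) : S)) = (18112 : S) by norm_cast, key]
  exact Ideal.add_mem _ (Ideal.add_mem _ (Ideal.add_mem _
    (Ideal.mul_mem_left _ _ (pderiv_mem_jacobianIdeal _ _))
    (Ideal.mul_mem_left _ _ (pderiv_mem_jacobianIdeal _ _)))
    (Ideal.mul_mem_left _ _ (pderiv_mem_jacobianIdeal _ _)))
    (Ideal.mul_mem_left _ _ (pderiv_mem_jacobianIdeal _ _))

/-- `x_4^9 ∈ J^F` (certificate `2264·x_4^9 = Σ h_u ∂_u F`, exact linear algebra). [cite: Kloosterman2025, Example 4.3 ("X = V(f) is smooth")] -/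
theorem ex43_X4_pow_mem [CharZero K] : (X 4 : S) ^ 9 ∈ jacobianIdeal F₄₃ := by
  refine mem_of_natCast_mul_mem 2264 (Nat.cast_ne_zero.mpr (by norm_num)) ?_
  have key : (2264 : S) * x 4 ^ 9 =
      ((-324 : S) * x 0 * x 2 ^ 2 * x 4 ^ 2 * x 6 + (-207 : S) * x 0 * x 4 ^ 4 * x 6 + (108 : S) * x 0 * x 4 ^ 2 * x 6 ^ 3 + (3456 : S) * x 2 * x 4 ^ 3 * x 6 ^ 2) * pderiv 0 F₄₃ +
      ((972 : S) * x 2 ^ 3 * x 4 ^ 2 * x 6 + (621 : S) * x 2 * x 4 ^ 4 * x 6 + (-324 : S) * x 2 * x 4 ^ 2 * x 6 ^ 3) * pderiv 2 F₄₃ +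
      ((-5184 : S) * x 0 * x 2 * x 4 ^ 2 * x 6 ^ 2 + (-1296 : S) * x 2 ^ 4 * x 4 * x 6 + (-1152 : S) * x 2 ^ 2 * x 4 ^ 3 * x 6 + (432 : S) * x 2 ^ 2 * x 4 * x 6 ^ 3 + (-207 : S) * x 4 ^ 5 * x 6 + (7884 : S) * x 4 ^ 3 * x 6 ^ 3 + (2592 : S) * x 4 * x 6 ^ 5) * pderiv 4 F₄₃ +
      ((432 : S) * x 2 ^ 4 * x 6 ^ 2 + (-144 : S) * x 2 ^ 2 * x 6 ^ 4 + (2264 : S) * x 4 ^ 6 + (-6171 : S) * x 4 ^ 4 * x 6 ^ 2 + (-4932 : S) * x 4 ^ 2 * x 6 ^ 4 + (-864 : S) * x 6 ^ 6) * pderiv 6 F₄₃ := by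
    rw [ex43_pderiv_0, ex43_pderiv_2, ex43_pderiv_4, ex43_pderiv_6]
    ring
  rw [show (((2264 : ℕ) : S)) = (2264 : S) by norm_cast, key]
  exact Ideal.add_mem _ (Ideal.add_mem _ (Ideal.add_mem _
    (Ideal.mul_mem_left _ _ (pderiv_mem_jacobianIdeal _ _))
    (Ideal.mul_mem_left _ _ (pderiv_mem_jacobianIdeal _ _)))
    (Ideal.mul_mem_left _ _ (pderiv_mem_jacobianIdeal _ _)))
    (Ideal.mul_mem_left _ _ (pderiv_mem_jacobianIdeal _ _))

/-- `x_6^9 ∈ J^F` (certificate `6792·x_6^9 = Σ h_u ∂_u F`, exact linear algebra). [cite: Kloosterman2025, Example 4.3 ("X = V(f) is smooth")] -/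
theorem ex43_X6_pow_mem [CharZero K] : (X 6 : S) ^ 9 ∈ jacobianIdeal F₄₃ := by
  refine mem_of_natCast_mul_mem 6792 (Nat.cast_ne_zero.mpr (by norm_num)) ?_
  have key : (6792 : S) * x 6 ^ 9 =
      ((4 : S) * x 0 * x 2 ^ 2 * x 4 ^ 3 + (-249 : S) * x 0 * x 4 ^ 5 + (-756 : S) * x 0 * x 4 ^ 3 * x 6 ^ 2 + (2976 : S) * x 2 * x 4 ^ 4 * x 6 + (9056 : S) * x 2 * x 4 ^ 2 * x 6 ^ 3) * pderiv 0 F₄₃ +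
      ((-12 : S) * x 2 ^ 3 * x 4 ^ 3 + (747 : S) * x 2 * x 4 ^ 5 + (2268 : S) * x 2 * x 4 ^ 3 * x 6 ^ 2) * pderiv 2 F₄₃ +
      ((-4464 : S) * x 0 * x 2 * x 4 ^ 3 * x 6 + (-13584 : S) * x 0 * x 2 * x 4 * x 6 ^ 3 + (16 : S) * x 2 ^ 4 * x 4 ^ 2 + (-992 : S) * x 2 ^ 2 * x 4 ^ 4 + (-3024 : S) * x 2 ^ 2 * x 4 ^ 2 * x 6 ^ 2 + (-249 : S) * x 4 ^ 6 + (5940 : S) * x 4 ^ 4 * x 6 ^ 2 + (22608 : S) * x 4 ^ 2 * x 6 ^ 4 + (6792 : S) * x 6 ^ 6) * pderiv 4 F₄₃ +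
      ((-3024 : S) * x 2 ^ 4 * x 4 * x 6 + (1008 : S) * x 2 ^ 2 * x 4 * x 6 ^ 3 + (747 : S) * x 4 ^ 5 * x 6 + (-19812 : S) * x 4 ^ 3 * x 6 ^ 3 + (-14328 : S) * x 4 * x 6 ^ 5) * pderiv 6 F₄₃ := by
    rw [ex43_pderiv_0, ex43_pderiv_2, ex43_pderiv_4, ex43_pderiv_6]
    ring
  rw [show (((6792 : ℕ) : S)) = (6792 : S) by norm_cast, key]
  exact Ideal.add_mem _ (Ideal.add_mem _ (Ideal.add_mem _
    (Ideal.mul_mem_left _ _ (pderiv_mem_jacobianIdeal _ _))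
    (Ideal.mul_mem_left _ _ (pderiv_mem_jacobianIdeal _ _)))
    (Ideal.mul_mem_left _ _ (pderiv_mem_jacobianIdeal _ _)))
    (Ideal.mul_mem_left _ _ (pderiv_mem_jacobianIdeal _ _))

/-- `x_1^9 ∈ J^F` (certificate `326016·x_1^9 = Σ h_u ∂_u F`, exact linear algebra). [cite: Kloosterman2025, Example 4.3 ("X = V(f) is smooth")] -/
theorem ex43_X1_pow_mem [CharZero K] : (X 1 : S) ^ 9 ∈ jacobianIdeal F₄₃ := by
  refine mem_of_natCast_mul_mem 326016 (Nat.cast_ne_zero.mpr (by norm_num)) ?_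
  have key : (326016 : S) * x 1 ^ 9 =
      ((-326016 : S) * x 1 ^ 5 * x 3 + (108672 : S) * x 1 ^ 3 * x 3 ^ 3 + (434688 : S) * x 1 ^ 3 * x 3 * x 5 ^ 2 + (-365472 : S) * x 1 ^ 2 * x 5 ^ 3 * x 7 + (-40752 : S) * x 1 * x 3 ^ 5 + (-207156 : S) * x 1 * x 3 ^ 3 * x 5 ^ 2 + (-543715 : S) * x 1 * x 3 * x 5 ^ 4 + (6819 : S) * x 1 * x 3 * x 5 ^ 2 * x 7 ^ 2 + (-26304 : S) * x 5 ^ 5 * x 7 + (-81504 : S) * x 5 ^ 3 * x 7 ^ 3) * pderiv 1 F₄₃ +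
      ((326016 : S) * x 1 ^ 6 + (-326016 : S) * x 1 ^ 4 * x 5 ^ 2 + (326016 : S) * x 1 ^ 2 * x 5 ^ 4 + (1096416 : S) * x 1 * x 3 * x 5 ^ 3 * x 7 + (13584 : S) * x 3 ^ 6 + (78108 : S) * x 3 ^ 4 * x 5 ^ 2 + (218409 : S) * x 3 ^ 2 * x 5 ^ 4 + (-20457 : S) * x 3 ^ 2 * x 5 ^ 2 * x 7 ^ 2 + (-326016 : S) * x 5 ^ 6) * pderiv 3 F₄₃ +
      ((-1461888 : S) * x 1 * x 3 ^ 2 * x 5 ^ 2 * x 7 + (-326016 : S) * x 1 * x 5 ^ 4 * x 7 + (122256 : S) * x 1 * x 5 ^ 2 * x 7 ^ 3 + (8768 : S) * x 3 ^ 3 * x 5 ^ 3 + (27276 : S) * x 3 ^ 3 * x 5 * x 7 ^ 2 + (651677 : S) * x 3 * x 5 ^ 5 + (2199651 : S) * x 3 * x 5 ^ 3 * x 7 ^ 2 + (730944 : S) * x 3 * x 5 * x 7 ^ 4) * pderiv 5 F₄₃ +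
      ((326016 : S) * x 1 * x 5 ^ 5 + (-40752 : S) * x 1 * x 5 * x 7 ^ 4 + (-9092 : S) * x 3 ^ 3 * x 7 ^ 3 + (-1928727 : S) * x 3 * x 5 ^ 4 * x 7 + (-1382945 : S) * x 3 * x 5 ^ 2 * x 7 ^ 3 + (-243648 : S) * x 3 * x 7 ^ 5) * pderiv 7 F₄₃ := by
    rw [ex43_pderiv_1, ex43_pderiv_3, ex43_pderiv_5, ex43_pderiv_7]
    ring
  rw [show (((326016 : ℕ) : S)) = (326016 : S) by norm_cast, key]
  exact Ideal.add_mem _ (Ideal.add_mem _ (Ideal.add_mem _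
    (Ideal.mul_mem_left _ _ (pderiv_mem_jacobianIdeal _ _))
    (Ideal.mul_mem_left _ _ (pderiv_mem_jacobianIdeal _ _)))
    (Ideal.mul_mem_left _ _ (pderiv_mem_jacobianIdeal _ _)))
    (Ideal.mul_mem_left _ _ (pderiv_mem_jacobianIdeal _ _))

/-- `x_3^9 ∈ J^F` (certificate `18112·x_3^9 = Σ h_u ∂_u F`, exact linear algebra). [cite: Kloosterman2025, Example 4.3 ("X = V(f) is smooth")] -/
theorem ex43_X3_pow_mem [CharZero K] : (X 3 : S) ^ 9 ∈ jacobianIdeal F₄₃ := by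
  refine mem_of_natCast_mul_mem 18112 (Nat.cast_ne_zero.mpr (by norm_num)) ?_
  have key : (18112 : S) * x 3 ^ 9 =
      ((6792 : S) * x 1 ^ 2 * x 3 ^ 4 + (-8490 : S) * x 1 ^ 2 * x 3 ^ 2 * x 5 ^ 2 + (8928 : S) * x 1 ^ 2 * x 5 ^ 4 + (6768 : S) * x 1 * x 3 * x 5 ^ 3 * x 7 + (18112 : S) * x 3 ^ 6 + (-18112 : S) * x 3 ^ 4 * x 5 ^ 2 + (18112 : S) * x 3 ^ 2 * x 5 ^ 4 + (5952 : S) * x 5 ^ 6) * pderiv 1 F₄₃ +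
      ((-20376 : S) * x 1 * x 3 ^ 5 + (25470 : S) * x 1 * x 3 ^ 3 * x 5 ^ 2 + (-26784 : S) * x 1 * x 3 * x 5 ^ 4 + (-20304 : S) * x 3 ^ 2 * x 5 ^ 3 * x 7) * pderiv 3 F₄₃ +
      ((54 : S) * x 1 * x 3 ^ 2 * x 5 ^ 3 + (27072 : S) * x 3 ^ 3 * x 5 ^ 2 * x 7 + (6687 : S) * x 3 * x 5 ^ 4 * x 7 + (-27 : S) * x 3 * x 5 ^ 2 * x 7 ^ 3) * pderiv 5 F₄₃ +
      ((-24064 : S) * x 3 ^ 3 * x 5 ^ 3 + (-9024 : S) * x 3 ^ 3 * x 5 * x 7 ^ 2 + (-5952 : S) * x 3 * x 5 ^ 5 + (-2205 : S) * x 3 * x 5 ^ 3 * x 7 ^ 2 + (9 : S) * x 3 * x 5 * x 7 ^ 4) * pderiv 7 F₄₃ := by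
    rw [ex43_pderiv_1, ex43_pderiv_3, ex43_pderiv_5, ex43_pderiv_7]
    ring
  rw [show (((18112 : ℕ) : S)) = (18112 : S) by norm_cast, key]
  exact Ideal.add_mem _ (Ideal.add_mem _ (Ideal.add_mem _
    (Ideal.mul_mem_left _ _ (pderiv_mem_jacobianIdeal _ _))
    (Ideal.mul_mem_left _ _ (pderiv_mem_jacobianIdeal _ _)))
    (Ideal.mul_mem_left _ _ (pderiv_mem_jacobianIdeal _ _)))
    (Ideal.mul_mem_left _ _ (pderiv_mem_jacobianIdeal _ _))

/-- `x_5^9 ∈ J^F` (certificate `2264·x_5^9 = Σ h_u ∂_u F`, exact linear algebra). [cite: Kloosterman2025, Example 4.3 ("X = V(f) is smooth")] -/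
theorem ex43_X5_pow_mem [CharZero K] : (X 5 : S) ^ 9 ∈ jacobianIdeal F₄₃ := by
  refine mem_of_natCast_mul_mem 2264 (Nat.cast_ne_zero.mpr (by norm_num)) ?_
  have key : (2264 : S) * x 5 ^ 9 =
      ((-324 : S) * x 1 * x 3 ^ 2 * x 5 ^ 2 * x 7 + (-207 : S) * x 1 * x 5 ^ 4 * x 7 + (108 : S) * x 1 * x 5 ^ 2 * x 7 ^ 3 + (3456 : S) * x 3 * x 5 ^ 3 * x 7 ^ 2) * pderiv 1 F₄₃ +
      ((972 : S) * x 3 ^ 3 * x 5 ^ 2 * x 7 + (621 : S) * x 3 * x 5 ^ 4 * x 7 + (-324 : S) * x 3 * x 5 ^ 2 * x 7 ^ 3) * pderiv 3 F₄₃ +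
      ((-5184 : S) * x 1 * x 3 * x 5 ^ 2 * x 7 ^ 2 + (-1296 : S) * x 3 ^ 4 * x 5 * x 7 + (-1152 : S) * x 3 ^ 2 * x 5 ^ 3 * x 7 + (432 : S) * x 3 ^ 2 * x 5 * x 7 ^ 3 + (-207 : S) * x 5 ^ 5 * x 7 + (7884 : S) * x 5 ^ 3 * x 7 ^ 3 + (2592 : S) * x 5 * x 7 ^ 5) * pderiv 5 F₄₃ +
      ((432 : S) * x 3 ^ 4 * x 7 ^ 2 + (-144 : S) * x 3 ^ 2 * x 7 ^ 4 + (2264 : S) * x 5 ^ 6 + (-6171 : S) * x 5 ^ 4 * x 7 ^ 2 + (-4932 : S) * x 5 ^ 2 * x 7 ^ 4 + (-864 : S) * x 7 ^ 6) * pderiv 7 F₄₃ := by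
    rw [ex43_pderiv_1, ex43_pderiv_3, ex43_pderiv_5, ex43_pderiv_7]
    ring
  rw [show (((2264 : ℕ) : S)) = (2264 : S) by norm_cast, key]
  exact Ideal.add_mem _ (Ideal.add_mem _ (Ideal.add_mem _
    (Ideal.mul_mem_left _ _ (pderiv_mem_jacobianIdeal _ _))
    (Ideal.mul_mem_left _ _ (pderiv_mem_jacobianIdeal _ _)))
    (Ideal.mul_mem_left _ _ (pderiv_mem_jacobianIdeal _ _)))
    (Ideal.mul_mem_left _ _ (pderiv_mem_jacobianIdeal _ _))

/-- `x_7^9 ∈ J^F` (certificate `6792·x_7^9 = Σ h_u ∂_u F`, exact linear algebra). [cite: Kloosterman2025, Example 4.3 ("X = V(f) is smooth")] -/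
theorem ex43_X7_pow_mem [CharZero K] : (X 7 : S) ^ 9 ∈ jacobianIdeal F₄₃ := by
  refine mem_of_natCast_mul_mem 6792 (Nat.cast_ne_zero.mpr (by norm_num)) ?_
  have key : (6792 : S) * x 7 ^ 9 =
      ((4 : S) * x 1 * x 3 ^ 2 * x 5 ^ 3 + (-249 : S) * x 1 * x 5 ^ 5 + (-756 : S) * x 1 * x 5 ^ 3 * x 7 ^ 2 + (2976 : S) * x 3 * x 5 ^ 4 * x 7 + (9056 : S) * x 3 * x 5 ^ 2 * x 7 ^ 3) * pderiv 1 F₄₃ +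
      ((-12 : S) * x 3 ^ 3 * x 5 ^ 3 + (747 : S) * x 3 * x 5 ^ 5 + (2268 : S) * x 3 * x 5 ^ 3 * x 7 ^ 2) * pderiv 3 F₄₃ +
      ((-4464 : S) * x 1 * x 3 * x 5 ^ 3 * x 7 + (-13584 : S) * x 1 * x 3 * x 5 * x 7 ^ 3 + (16 : S) * x 3 ^ 4 * x 5 ^ 2 + (-992 : S) * x 3 ^ 2 * x 5 ^ 4 + (-3024 : S) * x 3 ^ 2 * x 5 ^ 2 * x 7 ^ 2 + (-249 : S) * x 5 ^ 6 + (5940 : S) * x 5 ^ 4 * x 7 ^ 2 + (22608 : S) * x 5 ^ 2 * x 7 ^ 4 + (6792 : S) * x 7 ^ 6) * pderiv 5 F₄₃ +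
      ((-3024 : S) * x 3 ^ 4 * x 5 * x 7 + (1008 : S) * x 3 ^ 2 * x 5 * x 7 ^ 3 + (747 : S) * x 5 ^ 5 * x 7 + (-19812 : S) * x 5 ^ 3 * x 7 ^ 3 + (-14328 : S) * x 5 * x 7 ^ 5) * pderiv 7 F₄₃ := by
    rw [ex43_pderiv_1, ex43_pderiv_3, ex43_pderiv_5, ex43_pderiv_7]
    ring
  rw [show (((6792 : ℕ) : S)) = (6792 : S) by norm_cast, key]
  exact Ideal.add_mem _ (Ideal.add_mem _ (Ideal.add_mem _
    (Ideal.mul_mem_left _ _ (pderiv_mem_jacobianIdeal _ _))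
    (Ideal.mul_mem_left _ _ (pderiv_mem_jacobianIdeal _ _)))
    (Ideal.mul_mem_left _ _ (pderiv_mem_jacobianIdeal _ _)))
    (Ideal.mul_mem_left _ _ (pderiv_mem_jacobianIdeal _ _))


/-- **`X = V(f)` is smooth** (Example 4.3): `x_l^9 ∈ J^f` for all eight variables, so the Jacobian ring is
finite-dimensional. [cite: Kloosterman2025, Example 4.3] -/
theorem ex43_X_pow_mem [CharZero K] : ∀ l, (X l : S) ^ 9 ∈ jacobianIdeal F₄₃ := by
  intro l
  fin_cases l
  exacts [ex43_X0_pow_mem, ex43_X1_pow_mem, ex43_X2_pow_mem, ex43_X3_pow_mem, ex43_X4_pow_mem,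
    ex43_X5_pow_mem, ex43_X6_pow_mem, ex43_X7_pow_mem]

variable (κ₀ : Fin 2 ⊕ Fin 2 ≃ Fin (3 + 1))

local notation "I₁⁴³" => (Ideal.span (Set.range (plane₁Gens κ₀ (ex43GA (K := K)) ex43GC)) ⊔
  Ideal.span (Set.range (plane₁Cofs κ₀ (ex43H (K := K)) ex43Q ex43P)))
local notation "I₂⁴³" => (Ideal.span (Set.range (plane₂Gens κ₀ (ex43H (K := K)) ex43GC)) ⊔
  Ideal.span (Set.range (plane₂Cofs κ₀ (ex43GA (K := K)) ex43Q ex43P)))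

/-- **The colon element of Example 4.3**: `u = (x_0²+x_4²)(x_1²+x_5²) ∈ (I₂ : I₁)` — `x_0u = (x_1²+x_5²)·x_0Q_{02} −
x_2·(x_0x_2(x_1²+x_5²))`, `x_1u = (x_0²+x_4²)·x_1Q_{13} − x_3·((x_0²+x_4²)x_1x_3)`, and the other generators of
`I₁ = (x_0,x_1,x_6,x_7,x_2Q_{02},x_3Q_{13},P_6,P_7)` already lie in `I₂`. (This one element replaces the rank
computation of the `18 × 18` Gram matrix: see `ex43_monomial_mem`.) [cite: Kloosterman2025, Example 4.3] -/
theorem ex43_u_mem_colon : (x 0 ^ 2 + x 4 ^ 2) * (x 1 ^ 2 + x 5 ^ 2) ∈ (I₂⁴³).colon ((I₁⁴³ : Ideal S) : Set S) := by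
  refine mem_colon_of_le_colon_singleton (plane₁_le κ₀ ex43GA ex43H ex43GC ex43Q ex43P ?_ ?_ ?_ ?_)
  · refine Fin.forall_fin_two.mpr ⟨Submodule.mem_colon_singleton.mpr ?_, Submodule.mem_colon_singleton.mpr ?_⟩
    · have e : ex43GA (K := K) 0 • ((x 0 ^ 2 + x 4 ^ 2) * (x 1 ^ 2 + x 5 ^ 2)) =
          (x 1 ^ 2 + x 5 ^ 2) * (∑ i, ex43GA i * ex43Q i 0) - (x 0 * x 2 * (x 1 ^ 2 + x 5 ^ 2)) * ex43H 0 := by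
        simp only [smul_eq_mul, Fin.sum_univ_two, ex43GA_zero, ex43GA_one, ex43Q_zero_zero, ex43Q_one_zero,
          ex43H_zero]
        ring
      rw [e]
      exact sub_mem (Ideal.mul_mem_left _ _ (sum_mem_plane₂ κ₀ ex43GA ex43H ex43GC ex43Q ex43P 0))
        (Ideal.mul_mem_left _ _ (h_mem_plane₂ κ₀ ex43GA ex43H ex43GC ex43Q ex43P 0))
    · have e : ex43GA (K := K) 1 • ((x 0 ^ 2 + x 4 ^ 2) * (x 1 ^ 2 + x 5 ^ 2)) =
          (x 0 ^ 2 + x 4 ^ 2) * (∑ i, ex43GA i * ex43Q i 1) - ((x 0 ^ 2 + x 4 ^ 2) * x 1 * x 3) * ex43H 1 := by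
        simp only [smul_eq_mul, Fin.sum_univ_two, ex43GA_zero, ex43GA_one, ex43Q_zero_one, ex43Q_one_one,
          ex43H_one]
        ring
      rw [e]
      exact sub_mem (Ideal.mul_mem_left _ _ (sum_mem_plane₂ κ₀ ex43GA ex43H ex43GC ex43Q ex43P 1))
        (Ideal.mul_mem_left _ _ (h_mem_plane₂ κ₀ ex43GA ex43H ex43GC ex43Q ex43P 1))
  · intro m
    refine Submodule.mem_colon_singleton.mpr ?_
    rw [smul_eq_mul]
    exact Ideal.mul_mem_right _ _ (gC_mem_plane₂ κ₀ ex43GA ex43H ex43GC ex43Q ex43P m)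
  · intro i
    refine Submodule.mem_colon_singleton.mpr ?_
    rw [smul_eq_mul]
    exact Ideal.mul_mem_right _ _
      (Ideal.sum_mem _ fun j _ => Ideal.mul_mem_right _ _ (h_mem_plane₂ κ₀ ex43GA ex43H ex43GC ex43Q ex43P j))
  · intro m
    refine Submodule.mem_colon_singleton.mpr ?_
    rw [smul_eq_mul]
    exact Ideal.mul_mem_right _ _ (P_mem_plane₂ κ₀ ex43GA ex43H ex43GC ex43Q ex43P m)

/-- **`S_4 ⊆ I₁ + (I₂ : I₁)` for Example 4.3**: every monomial of degree `4` is divisible by one of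
`x_0, x_1, x_6, x_7 ∈ I₁`, `x_2, x_3 ∈ I₂ ⊆ (I₂:I₁)`, `x_4³ = P_6 − x_4x_6·x_6 ∈ I₁`, `x_5³ ∈ I₁`, or equals
`x_4²x_5² = u − x_0·x_0(x_1²+x_5²) − x_1·x_1x_4² ∈ I₁ + (I₂:I₁)`. [cite: Kloosterman2025, Example 4.3] -/
theorem ex43_monomial_mem {s : Fin (2 * 3 + 2) →₀ ℕ} (hs : s.degree = 4) :
    monomial s (1 : K) ∈ I₁⁴³ ⊔ (I₂⁴³).colon ((I₁⁴³ : Ideal S) : Set S) := by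
  have hx0 : x 0 ∈ I₁⁴³ ⊔ (I₂⁴³).colon ((I₁⁴³ : Ideal S) : Set S) :=
    Ideal.mem_sup_left (gA_mem_plane₁ κ₀ ex43GA ex43H ex43GC ex43Q ex43P 0)
  have hx1 : x 1 ∈ I₁⁴³ ⊔ (I₂⁴³).colon ((I₁⁴³ : Ideal S) : Set S) :=
    Ideal.mem_sup_left (gA_mem_plane₁ κ₀ ex43GA ex43H ex43GC ex43Q ex43P 1)
  have hx6 : x 6 ∈ I₁⁴³ ⊔ (I₂⁴³).colon ((I₁⁴³ : Ideal S) : Set S) :=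
    Ideal.mem_sup_left (gC_mem_plane₁ κ₀ ex43GA ex43H ex43GC ex43Q ex43P 0)
  have hx7 : x 7 ∈ I₁⁴³ ⊔ (I₂⁴³).colon ((I₁⁴³ : Ideal S) : Set S) :=
    Ideal.mem_sup_left (gC_mem_plane₁ κ₀ ex43GA ex43H ex43GC ex43Q ex43P 1)
  have hx2 : x 2 ∈ I₁⁴³ ⊔ (I₂⁴³).colon ((I₁⁴³ : Ideal S) : Set S) :=
    Ideal.mem_sup_right (le_colon_set _ _ (h_mem_plane₂ κ₀ ex43GA ex43H ex43GC ex43Q ex43P 0))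
  have hx3 : x 3 ∈ I₁⁴³ ⊔ (I₂⁴³).colon ((I₁⁴³ : Ideal S) : Set S) :=
    Ideal.mem_sup_right (le_colon_set _ _ (h_mem_plane₂ κ₀ ex43GA ex43H ex43GC ex43Q ex43P 1))
  have hx4 : x 4 ^ 3 ∈ I₁⁴³ ⊔ (I₂⁴³).colon ((I₁⁴³ : Ideal S) : Set S) := by
    have e : x 4 ^ 3 = ex43P 0 - x 4 * x 6 * ex43GC 0 := by simp only [ex43P_zero, ex43GC_zero]; ring
    rw [e]
    exact Ideal.mem_sup_left (sub_mem (P_mem_plane₁ κ₀ ex43GA ex43H ex43GC ex43Q ex43P 0)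
      (Ideal.mul_mem_left _ _ (gC_mem_plane₁ κ₀ ex43GA ex43H ex43GC ex43Q ex43P 0)))
  have hx5 : x 5 ^ 3 ∈ I₁⁴³ ⊔ (I₂⁴³).colon ((I₁⁴³ : Ideal S) : Set S) := by
    have e : x 5 ^ 3 = ex43P 1 - x 5 * x 7 * ex43GC 1 := by simp only [ex43P_one, ex43GC_one]; ring
    rw [e]
    exact Ideal.mem_sup_left (sub_mem (P_mem_plane₁ κ₀ ex43GA ex43H ex43GC ex43Q ex43P 1)
      (Ideal.mul_mem_left _ _ (gC_mem_plane₁ κ₀ ex43GA ex43H ex43GC ex43Q ex43P 1)))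
  have hx45 : x 4 ^ 2 * x 5 ^ 2 ∈ I₁⁴³ ⊔ (I₂⁴³).colon ((I₁⁴³ : Ideal S) : Set S) := by
    have e : x 4 ^ 2 * x 5 ^ 2 = (x 0 ^ 2 + x 4 ^ 2) * (x 1 ^ 2 + x 5 ^ 2) -
        (x 0 * (x 1 ^ 2 + x 5 ^ 2)) * ex43GA 0 - (x 4 ^ 2 * x 1) * ex43GA 1 := by
      simp only [ex43GA_zero, ex43GA_one]; ring
    rw [e]
    exact sub_mem (sub_mem (Ideal.mem_sup_right (ex43_u_mem_colon κ₀))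
      (Ideal.mul_mem_left _ _ (Ideal.mem_sup_left (gA_mem_plane₁ κ₀ ex43GA ex43H ex43GC ex43Q ex43P 0))))
      (Ideal.mul_mem_left _ _ (Ideal.mem_sup_left (gA_mem_plane₁ κ₀ ex43GA ex43H ex43GC ex43Q ex43P 1)))
  -- case analysis on the exponent vector
  have h8 : ∑ i, s i = s 0 + s 1 + s 2 + s 3 + s 4 + s 5 + s 6 + s 7 := Fin.sum_univ_eight _
  have hsum : s 0 + s 1 + s 2 + s 3 + s 4 + s 5 + s 6 + s 7 = 4 := by
    rw [← h8, ← Finsupp.degree_eq_sum]; exact hs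
  by_cases h0 : s 0 ≠ 0; · exact monomial_mem_of_X_mem hx0 h0
  by_cases h1 : s 1 ≠ 0; · exact monomial_mem_of_X_mem hx1 h1
  by_cases h2 : s 2 ≠ 0; · exact monomial_mem_of_X_mem hx2 h2
  by_cases h3 : s 3 ≠ 0; · exact monomial_mem_of_X_mem hx3 h3
  by_cases h6 : s 6 ≠ 0; · exact monomial_mem_of_X_mem hx6 h6
  by_cases h7 : s 7 ≠ 0; · exact monomial_mem_of_X_mem hx7 h7
  by_cases h4 : 3 ≤ s 4; · exact monomial_mem_of_X_pow_mem hx4 h4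
  by_cases h5 : 3 ≤ s 5; · exact monomial_mem_of_X_pow_mem hx5 h5
  push Not at h0 h1 h2 h3 h6 h7 h4 h5
  have e4 : s 4 = 2 := by omega
  have e5 : s 5 = 2 := by omega
  have hs' : s = Finsupp.single 4 2 + Finsupp.single 5 2 := by
    ext i
    fin_cases i <;> simp (config := { decide := true }) [h0, h1, h2, h3, e4, e5, h6, h7]
  have emon : monomial (Finsupp.single 4 2 + Finsupp.single 5 2) (1 : K) = x 4 ^ 2 * x 5 ^ 2 := by
    rw [X_pow_eq_monomial, X_pow_eq_monomial, monomial_mul, mul_one]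
  rw [hs', emon]
  exact hx45

/-- **Example 4.3, the base of the induction** ("the Gram matrix has full rank 18 and therefore there is no left
kernel"): for EVERY socle functional `ℓ₀` of `J^f` and the two cycle functionals `ℓ_j = ℓ₀(·D_j)` of `Π₁, Π₂`
(any indexing `κ₀` of the generators), the exceptional sets `E_{a'}(ℓ₁,ℓ₂)` are finite for `a' ≤ 4`, empty for
`a' < 4`, and `#E_4(ℓ₁,ℓ₂) ≤ h_{I₁+I₂}(4) = 1`. [cite: Kloosterman2025, Example 4.3, Proposition 4.6] -/
theorem ex43_base [CharZero K] {ℓ₀ : S →ₗ[K] K}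
    (hℓ₀ : ∀ p, ℓ₀ (homogeneousComponent ((2 * 3 + 2) * (4 - 2)) p) = ℓ₀ p) (hJ₀ : annIdeal ℓ₀ = jacobianIdeal F₄₃) :
    (∀ a' ≤ 4, (excessSet (ciCycleFunctional ℓ₀ (plane₁Gens κ₀ ex43GA ex43GC) (plane₁Cofs κ₀ ex43H ex43Q ex43P))
        (ciCycleFunctional ℓ₀ (plane₂Gens κ₀ ex43H ex43GC) (plane₂Cofs κ₀ ex43GA ex43Q ex43P)) a').Finite) ∧
    (∀ a' < 4, excessSet (ciCycleFunctional ℓ₀ (plane₁Gens κ₀ ex43GA ex43GC) (plane₁Cofs κ₀ ex43H ex43Q ex43P))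
        (ciCycleFunctional ℓ₀ (plane₂Gens κ₀ ex43H ex43GC) (plane₂Cofs κ₀ ex43GA ex43Q ex43P)) a' = ∅) ∧
    (excessSet (ciCycleFunctional ℓ₀ (plane₁Gens κ₀ ex43GA ex43GC) (plane₁Cofs κ₀ ex43H ex43Q ex43P))
        (ciCycleFunctional ℓ₀ (plane₂Gens κ₀ ex43H ex43GC) (plane₂Cofs κ₀ ex43GA ex43Q ex43P)) 4).ncard ≤ 1 := by
  have hd : 2 ≤ 4 := by norm_num
  have hN : 0 < 9 := by norm_num
  set ℓ₁ := ciCycleFunctional ℓ₀ (plane₁Gens κ₀ ex43GA ex43GC) (plane₁Cofs κ₀ ex43H ex43Q ex43P) with hℓ₁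
  set ℓ₂ := ciCycleFunctional ℓ₀ (plane₂Gens κ₀ ex43H ex43GC) (plane₂Cofs κ₀ ex43GA ex43Q ex43P) with hℓ₂
  have hXN₁ : ∀ l, (X l : S) ^ 9 ∈ jacobianIdeal (∑ i, plane₁Gens κ₀ ex43GA ex43GC i * plane₁Cofs κ₀ ex43H ex43Q ex43P i) := by
    rw [sum_plane₁Gens_mul_plane₁Cofs]; exact ex43_X_pow_mem
  have hJ₁ : annIdeal ℓ₀ = jacobianIdeal (∑ i, plane₁Gens κ₀ ex43GA ex43GC i * plane₁Cofs κ₀ ex43H ex43Q ex43P i) := by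
    rw [sum_plane₁Gens_mul_plane₁Cofs]; exact hJ₀
  have hXN₂ : ∀ l, (X l : S) ^ 9 ∈ jacobianIdeal (∑ i, plane₂Gens κ₀ ex43H ex43GC i * plane₂Cofs κ₀ ex43GA ex43Q ex43P i) := by
    rw [sum_plane₂Gens_mul_plane₂Cofs]; exact ex43_X_pow_mem
  have hJ₂ : annIdeal ℓ₀ = jacobianIdeal (∑ i, plane₂Gens κ₀ ex43H ex43GC i * plane₂Cofs κ₀ ex43GA ex43Q ex43P i) := by
    rw [sum_plane₂Gens_mul_plane₂Cofs]; exact hJ₀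
  have hI₁ : annIdeal ℓ₁ = I₁⁴³ :=
    annIdeal_ciCycleFunctional (d := 4) _ _ (fun _ => 1) (fun _ => 4 - 1) (isHomogeneous_plane₁Gens κ₀ ex43_hgA ex43_hgC)
      (isHomogeneous_plane₁Cofs κ₀ hd ex43_hh ex43_hQ ex43_hP) (fun _ => Nat.one_pos) (fun _ => by omega)
      (fun _ => by omega) hN hXN₁ hJ₁
  have hI₂ : annIdeal ℓ₂ = I₂⁴³ :=
    annIdeal_ciCycleFunctional (d := 4) _ _ (fun _ => 1) (fun _ => 4 - 1) (isHomogeneous_plane₂Gens κ₀ ex43_hh ex43_hgC)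
      (isHomogeneous_plane₂Cofs κ₀ hd ex43_hgA ex43_hQ ex43_hP) (fun _ => Nat.one_pos) (fun _ => by omega)
      (fun _ => by omega) hN hXN₂ hJ₂
  have hc₁ : ∀ p, ℓ₁ (homogeneousComponent ((3 + 1) * (4 - 2)) p) = ℓ₁ p :=
    ciCycleFunctional_homogeneousComponent _ _ (fun _ => 1) (fun _ => 4 - 1)
      (isHomogeneous_plane₁Gens κ₀ ex43_hgA ex43_hgC) (isHomogeneous_plane₁Cofs κ₀ hd ex43_hh ex43_hQ ex43_hP)
      (fun _ => Nat.one_pos) (fun _ => by omega) (fun _ => by omega) hℓ₀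
  have hc₂ : ∀ p, ℓ₂ (homogeneousComponent ((3 + 1) * (4 - 2)) p) = ℓ₂ p :=
    ciCycleFunctional_homogeneousComponent _ _ (fun _ => 1) (fun _ => 4 - 1)
      (isHomogeneous_plane₂Gens κ₀ ex43_hh ex43_hgC) (isHomogeneous_plane₂Cofs κ₀ hd ex43_hgA ex43_hQ ex43_hP)
      (fun _ => Nat.one_pos) (fun _ => by omega) (fun _ => by omega) hℓ₀
  -- the colon criterion in degree 4 (complementary degree 4)
  have hP4 : ∀ v : S, v.IsHomogeneous 4 → v ∈ annIdeal ℓ₁ → (∀ g ∈ annIdeal ℓ₁, v * g ∈ annIdeal ℓ₂) →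
      v ∈ annIdeal ℓ₂ := by
    refine colonCriterion_of_forall_mem_sup_colon hc₂ (a := 4) (b := 4) (by norm_num) fun w hw => ?_
    rw [hI₁, hI₂]
    exact mem_of_forall_monomial_mem hw fun s hs => ex43_monomial_mem κ₀ hs
  obtain ⟨-, -, hXs⟩ := X_pow_mem_planes κ₀ (ex43GA (K := K)) ex43H ex43GC ex43Q ex43P ex43_X_pow_mem
  have hhil : ∀ b, finrank K (homogeneousSubmodule (Fin (2 * 3 + 2)) K b) -
      finrank K (idealDegree (annIdeal ℓ₁ ⊔ annIdeal ℓ₂) b) = ciHilbert (List.replicate 2 (4 - 1)) b := by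
    intro b
    rw [hI₁, hI₂, planes_sup_eq_span]
    exact hilbert_span_twoPlanes_eq_ciHilbert hd κ₀ ex43GA ex43H ex43GC ex43P ex43_hgA ex43_hh ex43_hgC ex43_hP hXs b
  refine ⟨fun a' ha' => ?_, fun a' ha' => ?_, ?_⟩
  · exact excessSet_finite_of_colon hc₁ hc₂ (b := (3 + 1) * (4 - 2) - a') (by omega)
      (colonCriterion_of_le hc₂ (by norm_num) ha' hP4)
  · refine excessSet_eq_empty_of_hilbert_eq_zero hc₁ hc₂ (b := (3 + 1) * (4 - 2) - a') (by omega) ?_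
    rw [hhil]
    interval_cases a' <;> decide
  · calc (excessSet ℓ₁ ℓ₂ 4).ncard
        ≤ finrank K (homogeneousSubmodule (Fin (2 * 3 + 2)) K 4) - finrank K (idealDegree (annIdeal ℓ₁ ⊔ annIdeal ℓ₂) 4) :=
          ncard_excessSet_le_of_colon hc₁ hc₂ (b := 4) (by norm_num) hP4
      _ = ciHilbert (List.replicate 2 (4 - 1)) 4 := hhil 4
      _ = 1 := by decide

end Example43

/-! ## Section 6 — Example 4.4 (`d = 3`, `c = 3`, `k = 5`): the cubic tenfold

`f = Σ_{i=0}^{2} x_i x_{i+3} Q_{i,i+3} + Σ_{i=9}^{11} x_i P_i` with `Q_{i,i+3} = x_i + x_{i+3} + x_{i+6}`, `Q_{ij} = 0` otherwise,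
`P_i = x_{i−3}(x_{i−3} + x_i)`; `Π₁ = V(x_0,x_1,x_2,x_9,x_10,x_11)`, `Π₂ = V(x_3,x_4,x_5,x_9,x_10,x_11)` (two `5`-planes in
the cubic `X = V(f) ⊂ ℙ¹¹` meeting in codimension `3`). In the tree's normal form: `gA = (x_0,x_1,x_2)`, `h = (x_3,x_4,x_5)`,
`gC = (x_9,x_10,x_11)`, `Q = diag(Q_{03},Q_{14},Q_{25})`, `P = (P_9,P_10,P_11)`. -/

section Example44

open Literature.AlgebraicGeometry.Motives.UniversalHypersurface Literature.AlgebraicGeometry.Kloosterman2023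

variable {K : Type*} [Field K]

/-- `gA = (x_0, x_1, x_2)` (Example 4.4). [cite: Kloosterman2025, Example 4.4] -/
def ex44GA : Fin 3 → MvPolynomial (Fin (2 * 5 + 2)) K := ![X 0, X 1, X 2]

/-- `h = (x_3, x_4, x_5)` (Example 4.4). [cite: Kloosterman2025, Example 4.4] -/
def ex44H : Fin 3 → MvPolynomial (Fin (2 * 5 + 2)) K := ![X 3, X 4, X 5]

/-- `gC = (x_9, x_10, x_11)` (Example 4.4). [cite: Kloosterman2025, Example 4.4] -/
def ex44GC : Fin 3 → MvPolynomial (Fin (2 * 5 + 2)) K := ![X 9, X 10, X 11]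

/-- `Q = diag(x_0+x_3+x_6, x_1+x_4+x_7, x_2+x_5+x_8)` (Example 4.4). [cite: Kloosterman2025, Example 4.4] -/
def ex44Q : Fin 3 → Fin 3 → MvPolynomial (Fin (2 * 5 + 2)) K :=
  ![![X 0 + X 3 + X 6, 0, 0], ![0, X 1 + X 4 + X 7, 0], ![0, 0, X 2 + X 5 + X 8]]

/-- `P = (x_6(x_6+x_9), x_7(x_7+x_10), x_8(x_8+x_11))` (Example 4.4). [cite: Kloosterman2025, Example 4.4] -/
def ex44P : Fin 3 → MvPolynomial (Fin (2 * 5 + 2)) K :=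
  ![X 6 * (X 6 + X 9), X 7 * (X 7 + X 10), X 8 * (X 8 + X 11)]

local notation "S" => MvPolynomial (Fin (2 * 5 + 2)) K
local notation "x" n:max => (X n : MvPolynomial (Fin (2 * 5 + 2)) K)
local notation "F₄₄" => twoPlanesForm (ex44GA (K := K)) ex44H ex44GC ex44Q ex44P

/-- `gA_0 = x_0` (Example 4.4). [cite: Kloosterman2025, Example 4.4] -/
@[simp] theorem ex44GA_0 : ex44GA (K := K) 0 = X 0 := rfl
/-- `gA_1 = x_1` (Example 4.4). [cite: Kloosterman2025, Example 4.4] -/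
@[simp] theorem ex44GA_1 : ex44GA (K := K) 1 = X 1 := rfl
/-- `gA_2 = x_2` (Example 4.4). [cite: Kloosterman2025, Example 4.4] -/
@[simp] theorem ex44GA_2 : ex44GA (K := K) 2 = X 2 := rfl
/-- `h_0 = x_3` (Example 4.4). [cite: Kloosterman2025, Example 4.4] -/
@[simp] theorem ex44H_0 : ex44H (K := K) 0 = X 3 := rfl
/-- `h_1 = x_4` (Example 4.4). [cite: Kloosterman2025, Example 4.4] -/
@[simp] theorem ex44H_1 : ex44H (K := K) 1 = X 4 := rfl
/-- `h_2 = x_5` (Example 4.4). [cite: Kloosterman2025, Example 4.4] -/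
@[simp] theorem ex44H_2 : ex44H (K := K) 2 = X 5 := rfl
/-- `gC_0 = x_9` (Example 4.4). [cite: Kloosterman2025, Example 4.4] -/
@[simp] theorem ex44GC_0 : ex44GC (K := K) 0 = X 9 := rfl
/-- `gC_1 = x_10` (Example 4.4). [cite: Kloosterman2025, Example 4.4] -/
@[simp] theorem ex44GC_1 : ex44GC (K := K) 1 = X 10 := rfl
/-- `gC_2 = x_11` (Example 4.4). [cite: Kloosterman2025, Example 4.4] -/
@[simp] theorem ex44GC_2 : ex44GC (K := K) 2 = X 11 := rfl
/-- `Q_{03} = x_0+x_3+x_6` (Example 4.4). [cite: Kloosterman2025, Example 4.4] -/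
@[simp] theorem ex44Q_00 : ex44Q (K := K) 0 0 = X 0 + X 3 + X 6 := rfl
/-- `Q_{04} = 0` (Example 4.4). [cite: Kloosterman2025, Example 4.4] -/
@[simp] theorem ex44Q_01 : ex44Q (K := K) 0 1 = 0 := rfl
/-- `Q_{05} = 0` (Example 4.4). [cite: Kloosterman2025, Example 4.4] -/
@[simp] theorem ex44Q_02 : ex44Q (K := K) 0 2 = 0 := rfl
/-- `Q_{13} = 0` (Example 4.4). [cite: Kloosterman2025, Example 4.4] -/
@[simp] theorem ex44Q_10 : ex44Q (K := K) 1 0 = 0 := rfl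
/-- `Q_{14} = x_1+x_4+x_7` (Example 4.4). [cite: Kloosterman2025, Example 4.4] -/
@[simp] theorem ex44Q_11 : ex44Q (K := K) 1 1 = X 1 + X 4 + X 7 := rfl
/-- `Q_{15} = 0` (Example 4.4). [cite: Kloosterman2025, Example 4.4] -/
@[simp] theorem ex44Q_12 : ex44Q (K := K) 1 2 = 0 := rfl
/-- `Q_{23} = 0` (Example 4.4). [cite: Kloosterman2025, Example 4.4] -/
@[simp] theorem ex44Q_20 : ex44Q (K := K) 2 0 = 0 := rfl
/-- `Q_{24} = 0` (Example 4.4). [cite: Kloosterman2025, Example 4.4] -/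
@[simp] theorem ex44Q_21 : ex44Q (K := K) 2 1 = 0 := rfl
/-- `Q_{25} = x_2+x_5+x_8` (Example 4.4). [cite: Kloosterman2025, Example 4.4] -/
@[simp] theorem ex44Q_22 : ex44Q (K := K) 2 2 = X 2 + X 5 + X 8 := rfl
/-- `P_9 = x_6(x_6+x_9)` (Example 4.4). [cite: Kloosterman2025, Example 4.4] -/
@[simp] theorem ex44P_0 : ex44P (K := K) 0 = X 6 * (X 6 + X 9) := rfl
/-- `P_{10} = x_7(x_7+x_{10})` (Example 4.4). [cite: Kloosterman2025, Example 4.4] -/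
@[simp] theorem ex44P_1 : ex44P (K := K) 1 = X 7 * (X 7 + X 10) := rfl
/-- `P_{11} = x_8(x_8+x_{11})` (Example 4.4). [cite: Kloosterman2025, Example 4.4] -/
@[simp] theorem ex44P_2 : ex44P (K := K) 2 = X 8 * (X 8 + X 11) := rfl

/-- Example 4.4's `f`, written out. [cite: Kloosterman2025, Example 4.4] -/
theorem ex44Form_eq : F₄₄ =
    x 0 * x 3 * (x 0 + x 3 + x 6) + x 1 * x 4 * (x 1 + x 4 + x 7) + x 2 * x 5 * (x 2 + x 5 + x 8) +
      x 9 * (x 6 * (x 6 + x 9)) + x 10 * (x 7 * (x 7 + x 10)) + x 11 * (x 8 * (x 8 + x 11)) := by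
  simp only [twoPlanesForm, Fin.sum_univ_three, ex44GA_0, ex44GA_1, ex44GA_2, ex44H_0, ex44H_1, ex44H_2, ex44GC_0,
    ex44GC_1, ex44GC_2, ex44Q_00, ex44Q_01, ex44Q_02, ex44Q_10, ex44Q_11, ex44Q_12, ex44Q_20, ex44Q_21, ex44Q_22,
    ex44P_0, ex44P_1, ex44P_2]
  ring

/-- The `g_i` are linear forms (Example 4.4). [cite: Kloosterman2025, Example 4.4] -/
theorem ex44_hgA : ∀ i, (ex44GA (K := K) i).IsHomogeneous 1 := by
  intro i; fin_cases i
  exacts [isHomogeneous_X K 0, isHomogeneous_X K 1, isHomogeneous_X K 2]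

/-- The `h_j` are linear forms (Example 4.4). [cite: Kloosterman2025, Example 4.4] -/
theorem ex44_hh : ∀ j, (ex44H (K := K) j).IsHomogeneous 1 := by
  intro j; fin_cases j
  exacts [isHomogeneous_X K 3, isHomogeneous_X K 4, isHomogeneous_X K 5]

/-- The `g'_m` are linear forms (Example 4.4). [cite: Kloosterman2025, Example 4.4] -/
theorem ex44_hgC : ∀ m, (ex44GC (K := K) m).IsHomogeneous 1 := by
  intro m; fin_cases m
  exacts [isHomogeneous_X K 9, isHomogeneous_X K 10, isHomogeneous_X K 11]

/-- The `Q_{ij}` are linear (`d − 2 = 1`) (Example 4.4). [cite: Kloosterman2025, Example 4.4] -/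
theorem ex44_hQ : ∀ i j, (ex44Q (K := K) i j).IsHomogeneous (3 - 2) := by
  intro i j
  fin_cases i <;> fin_cases j
  · exact ((isHomogeneous_X K 0).add (isHomogeneous_X K 3)).add (isHomogeneous_X K 6)
  · exact isHomogeneous_zero _ _ _
  · exact isHomogeneous_zero _ _ _
  · exact isHomogeneous_zero _ _ _
  · exact ((isHomogeneous_X K 1).add (isHomogeneous_X K 4)).add (isHomogeneous_X K 7)
  · exact isHomogeneous_zero _ _ _
  · exact isHomogeneous_zero _ _ _
  · exact isHomogeneous_zero _ _ _
  · exact ((isHomogeneous_X K 2).add (isHomogeneous_X K 5)).add (isHomogeneous_X K 8)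

/-- The `P_m` are quadrics (`d − 1 = 2`) (Example 4.4). [cite: Kloosterman2025, Example 4.4] -/
theorem ex44_hP : ∀ m, (ex44P (K := K) m).IsHomogeneous (3 - 1) := by
  intro m; fin_cases m
  · exact (isHomogeneous_X K 6).mul ((isHomogeneous_X K 6).add (isHomogeneous_X K 9))
  · exact (isHomogeneous_X K 7).mul ((isHomogeneous_X K 7).add (isHomogeneous_X K 10))
  · exact (isHomogeneous_X K 8).mul ((isHomogeneous_X K 8).add (isHomogeneous_X K 11))

/-- `Π₁ = V(x_0,x_1,x_2,x_9,x_10,x_11)` and `Π₂ = V(x_3,x_4,x_5,x_9,x_10,x_11)` are two `5`-planes of `ℙ^{11}` meeting in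
codimension `3`: the nine linear generators `gA, h, gC` are linearly independent. [cite: Kloosterman2025, Example 4.4] -/
theorem ex44_planes_linearIndependent :
    LinearIndependent K (Sum.elim (Sum.elim (ex44GA (K := K)) ex44H) ex44GC) :=
  linearIndependent_of_eq_X_comp (Sum.elim (Sum.elim ![0, 1, 2] ![3, 4, 5]) ![9, 10, 11]) (by decide) _
    (fun i => by rcases i with (i | i) | i <;> fin_cases i <;> rfl)

/-- `∂f/∂x_0`. [cite: Kloosterman2025, Example 4.4] -/
theorem ex44_pderiv_0 : pderiv 0 F₄₄ = (2 : S) * x 0 * x 3 + x 3 ^ 2 + x 3 * x 6 := by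
  rw [ex44Form_eq]
  simp (config := { decide := true }) only [map_add, Derivation.leibniz, pderiv_X, Pi.single_apply, if_true, if_false,
    smul_eq_mul]
  ring

/-- `∂f/∂x_3`. [cite: Kloosterman2025, Example 4.4] -/
theorem ex44_pderiv_3 : pderiv 3 F₄₄ = x 0 ^ 2 + (2 : S) * x 0 * x 3 + x 0 * x 6 := by
  rw [ex44Form_eq]
  simp (config := { decide := true }) only [map_add, Derivation.leibniz, pderiv_X, Pi.single_apply, if_true, if_false,
    smul_eq_mul]
  ring

/-- `∂f/∂x_6`. [cite: Kloosterman2025, Example 4.4] -/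
theorem ex44_pderiv_6 : pderiv 6 F₄₄ = x 0 * x 3 + (2 : S) * x 6 * x 9 + x 9 ^ 2 := by
  rw [ex44Form_eq]
  simp (config := { decide := true }) only [map_add, Derivation.leibniz, pderiv_X, Pi.single_apply, if_true, if_false,
    smul_eq_mul]
  ring

/-- `∂f/∂x_9`. [cite: Kloosterman2025, Example 4.4] -/
theorem ex44_pderiv_9 : pderiv 9 F₄₄ = x 6 ^ 2 + (2 : S) * x 6 * x 9 := by
  rw [ex44Form_eq]
  simp (config := { decide := true }) only [map_add, Derivation.leibniz, pderiv_X, Pi.single_apply, if_true, if_false,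
    smul_eq_mul]
  ring

/-- `∂f/∂x_1`. [cite: Kloosterman2025, Example 4.4] -/
theorem ex44_pderiv_1 : pderiv 1 F₄₄ = (2 : S) * x 1 * x 4 + x 4 ^ 2 + x 4 * x 7 := by
  rw [ex44Form_eq]
  simp (config := { decide := true }) only [map_add, Derivation.leibniz, pderiv_X, Pi.single_apply, if_true, if_false,
    smul_eq_mul]
  ring

/-- `∂f/∂x_4`. [cite: Kloosterman2025, Example 4.4] -/
theorem ex44_pderiv_4 : pderiv 4 F₄₄ = x 1 ^ 2 + (2 : S) * x 1 * x 4 + x 1 * x 7 := by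
  rw [ex44Form_eq]
  simp (config := { decide := true }) only [map_add, Derivation.leibniz, pderiv_X, Pi.single_apply, if_true, if_false,
    smul_eq_mul]
  ring

/-- `∂f/∂x_7`. [cite: Kloosterman2025, Example 4.4] -/
theorem ex44_pderiv_7 : pderiv 7 F₄₄ = x 1 * x 4 + (2 : S) * x 7 * x 10 + x 10 ^ 2 := by
  rw [ex44Form_eq]
  simp (config := { decide := true }) only [map_add, Derivation.leibniz, pderiv_X, Pi.single_apply, if_true, if_false,
    smul_eq_mul]
  ring

/-- `∂f/∂x_10`. [cite: Kloosterman2025, Example 4.4] -/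
theorem ex44_pderiv_10 : pderiv 10 F₄₄ = x 7 ^ 2 + (2 : S) * x 7 * x 10 := by
  rw [ex44Form_eq]
  simp (config := { decide := true }) only [map_add, Derivation.leibniz, pderiv_X, Pi.single_apply, if_true, if_false,
    smul_eq_mul]
  ring

/-- `∂f/∂x_2`. [cite: Kloosterman2025, Example 4.4] -/
theorem ex44_pderiv_2 : pderiv 2 F₄₄ = (2 : S) * x 2 * x 5 + x 5 ^ 2 + x 5 * x 8 := by
  rw [ex44Form_eq]
  simp (config := { decide := true }) only [map_add, Derivation.leibniz, pderiv_X, Pi.single_apply, if_true, if_false,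
    smul_eq_mul]
  ring

/-- `∂f/∂x_5`. [cite: Kloosterman2025, Example 4.4] -/
theorem ex44_pderiv_5 : pderiv 5 F₄₄ = x 2 ^ 2 + (2 : S) * x 2 * x 5 + x 2 * x 8 := by
  rw [ex44Form_eq]
  simp (config := { decide := true }) only [map_add, Derivation.leibniz, pderiv_X, Pi.single_apply, if_true, if_false,
    smul_eq_mul]
  ring

/-- `∂f/∂x_8`. [cite: Kloosterman2025, Example 4.4] -/
theorem ex44_pderiv_8 : pderiv 8 F₄₄ = x 2 * x 5 + (2 : S) * x 8 * x 11 + x 11 ^ 2 := by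
  rw [ex44Form_eq]
  simp (config := { decide := true }) only [map_add, Derivation.leibniz, pderiv_X, Pi.single_apply, if_true, if_false,
    smul_eq_mul]
  ring

/-- `∂f/∂x_11`. [cite: Kloosterman2025, Example 4.4] -/
theorem ex44_pderiv_11 : pderiv 11 F₄₄ = x 8 ^ 2 + (2 : S) * x 8 * x 11 := by
  rw [ex44Form_eq]
  simp (config := { decide := true }) only [map_add, Derivation.leibniz, pderiv_X, Pi.single_apply, if_true, if_false,
    smul_eq_mul]
  ring

/-- `x_0^5 ∈ J^F` (certificate `414·x_0^5 = Σ h_u ∂_u F`, exact linear algebra). [cite: Kloosterman2025, Example 4.4 ("X = V(f) is smooth")] -/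
theorem ex44_X0_pow_mem [CharZero K] : (X 0 : S) ^ 5 ∈ jacobianIdeal F₄₄ := by
  refine mem_of_natCast_mul_mem 414 (Nat.cast_ne_zero.mpr (by norm_num)) ?_
  have key : (414 : S) * x 0 ^ 5 =
      ((-414 : S) * x 0 ^ 3 + (207 : S) * x 0 ^ 2 * x 3 + (621 : S) * x 0 ^ 2 * x 6 + (-138 : S) * x 0 * x 3 ^ 2 + (-303 : S) * x 0 * x 3 * x 6 + (-593 : S) * x 0 * x 6 ^ 2 + (-184 : S) * x 0 * x 6 * x 9 + (-1632 : S) * x 6 ^ 2 * x 9 + (-816 : S) * x 6 * x 9 ^ 2) * pderiv 0 F₄₄ +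
      ((414 : S) * x 0 ^ 3 + (-414 : S) * x 0 ^ 2 * x 6 + (414 : S) * x 0 * x 6 ^ 2 + (69 : S) * x 3 ^ 3 + (-222 : S) * x 3 ^ 2 * x 6 + (151 : S) * x 3 * x 6 ^ 2 + (92 : S) * x 3 * x 6 * x 9 + (-414 : S) * x 6 ^ 3) * pderiv 3 F₄₄ +
      ((-414 : S) * x 0 * x 6 ^ 2 + (276 : S) * x 0 * x 6 * x 9 + (816 : S) * x 3 ^ 2 * x 6 + (816 : S) * x 3 * x 6 ^ 2 + (1270 : S) * x 6 ^ 3 + (3356 : S) * x 6 ^ 2 * x 9 + (1632 : S) * x 6 * x 9 ^ 2) * pderiv 6 F₄₄ +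
      ((414 : S) * x 0 * x 6 ^ 2 + (-138 : S) * x 0 * x 9 ^ 2 + (-2540 : S) * x 6 ^ 2 * x 9 + (-2902 : S) * x 6 * x 9 ^ 2 + (-816 : S) * x 9 ^ 3) * pderiv 9 F₄₄ := by
    rw [ex44_pderiv_0, ex44_pderiv_3, ex44_pderiv_6, ex44_pderiv_9]
    ring
  rw [show (((414 : ℕ) : S)) = (414 : S) by norm_cast, key]
  exact Ideal.add_mem _ (Ideal.add_mem _ (Ideal.add_mem _
    (Ideal.mul_mem_left _ _ (pderiv_mem_jacobianIdeal _ _))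
    (Ideal.mul_mem_left _ _ (pderiv_mem_jacobianIdeal _ _)))
    (Ideal.mul_mem_left _ _ (pderiv_mem_jacobianIdeal _ _)))
    (Ideal.mul_mem_left _ _ (pderiv_mem_jacobianIdeal _ _))

/-- `x_3^5 ∈ J^F` (certificate `207·x_3^5 = Σ h_u ∂_u F`, exact linear algebra). [cite: Kloosterman2025, Example 4.4 ("X = V(f) is smooth")] -/
theorem ex44_X3_pow_mem [CharZero K] : (X 3 : S) ^ 5 ∈ jacobianIdeal F₄₄ := by
  refine mem_of_natCast_mul_mem 207 (Nat.cast_ne_zero.mpr (by norm_num)) ?_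
  have key : (207 : S) * x 3 ^ 5 =
      ((138 : S) * x 0 * x 3 ^ 2 + (-48 : S) * x 0 * x 3 * x 6 + (221 : S) * x 0 * x 6 ^ 2 + (46 : S) * x 0 * x 6 * x 9 + (207 : S) * x 3 ^ 3 + (-207 : S) * x 3 ^ 2 * x 6 + (207 : S) * x 3 * x 6 ^ 2 + (-207 : S) * x 6 ^ 3 + (-816 : S) * x 6 ^ 2 * x 9 + (-408 : S) * x 6 * x 9 ^ 2) * pderiv 0 F₄₄ +
      ((-276 : S) * x 3 ^ 3 + (96 : S) * x 3 ^ 2 * x 6 + (-442 : S) * x 3 * x 6 ^ 2 + (-92 : S) * x 3 * x 6 * x 9) * pderiv 3 F₄₄ +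
      ((408 : S) * x 3 ^ 2 * x 6 + (201 : S) * x 3 * x 6 ^ 2 + (138 : S) * x 3 * x 6 * x 9 + (635 : S) * x 6 ^ 3 + (1678 : S) * x 6 ^ 2 * x 9 + (816 : S) * x 6 * x 9 ^ 2) * pderiv 6 F₄₄ +
      ((207 : S) * x 3 * x 6 ^ 2 + (-69 : S) * x 3 * x 9 ^ 2 + (-1270 : S) * x 6 ^ 2 * x 9 + (-1451 : S) * x 6 * x 9 ^ 2 + (-408 : S) * x 9 ^ 3) * pderiv 9 F₄₄ := by
    rw [ex44_pderiv_0, ex44_pderiv_3, ex44_pderiv_6, ex44_pderiv_9]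
    ring
  rw [show (((207 : ℕ) : S)) = (207 : S) by norm_cast, key]
  exact Ideal.add_mem _ (Ideal.add_mem _ (Ideal.add_mem _
    (Ideal.mul_mem_left _ _ (pderiv_mem_jacobianIdeal _ _))
    (Ideal.mul_mem_left _ _ (pderiv_mem_jacobianIdeal _ _)))
    (Ideal.mul_mem_left _ _ (pderiv_mem_jacobianIdeal _ _)))
    (Ideal.mul_mem_left _ _ (pderiv_mem_jacobianIdeal _ _))

/-- `x_6^5 ∈ J^F` (certificate `69·x_6^5 = Σ h_u ∂_u F`, exact linear algebra). [cite: Kloosterman2025, Example 4.4 ("X = V(f) is smooth")] -/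
theorem ex44_X6_pow_mem [CharZero K] : (X 6 : S) ^ 5 ∈ jacobianIdeal F₄₄ := by
  refine mem_of_natCast_mul_mem 69 (Nat.cast_ne_zero.mpr (by norm_num)) ?_
  have key : (69 : S) * x 6 ^ 5 =
      ((24 : S) * x 0 * x 3 * x 6 + (16 : S) * x 0 * x 6 ^ 2 + (-144 : S) * x 6 ^ 2 * x 9 + (-72 : S) * x 6 * x 9 ^ 2) * pderiv 0 F₄₄ +
      ((-48 : S) * x 3 ^ 2 * x 6 + (-32 : S) * x 3 * x 6 ^ 2) * pderiv 3 F₄₄ +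
      ((72 : S) * x 3 ^ 2 * x 6 + (72 : S) * x 3 * x 6 ^ 2 + (16 : S) * x 6 ^ 3 + (288 : S) * x 6 ^ 2 * x 9 + (144 : S) * x 6 * x 9 ^ 2) * pderiv 6 F₄₄ +
      ((69 : S) * x 6 ^ 3 + (-170 : S) * x 6 ^ 2 * x 9 + (-252 : S) * x 6 * x 9 ^ 2 + (-72 : S) * x 9 ^ 3) * pderiv 9 F₄₄ := by
    rw [ex44_pderiv_0, ex44_pderiv_3, ex44_pderiv_6, ex44_pderiv_9]
    ring
  rw [show (((69 : ℕ) : S)) = (69 : S) by norm_cast, key]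
  exact Ideal.add_mem _ (Ideal.add_mem _ (Ideal.add_mem _
    (Ideal.mul_mem_left _ _ (pderiv_mem_jacobianIdeal _ _))
    (Ideal.mul_mem_left _ _ (pderiv_mem_jacobianIdeal _ _)))
    (Ideal.mul_mem_left _ _ (pderiv_mem_jacobianIdeal _ _)))
    (Ideal.mul_mem_left _ _ (pderiv_mem_jacobianIdeal _ _))

/-- `x_9^5 ∈ J^F` (certificate `414·x_9^5 = Σ h_u ∂_u F`, exact linear algebra). [cite: Kloosterman2025, Example 4.4 ("X = V(f) is smooth")] -/
theorem ex44_X9_pow_mem [CharZero K] : (X 9 : S) ^ 5 ∈ jacobianIdeal F₄₄ := by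
  refine mem_of_natCast_mul_mem 414 (Nat.cast_ne_zero.mpr (by norm_num)) ?_
  have key : (414 : S) * x 9 ^ 5 =
      ((30 : S) * x 0 * x 3 * x 6 + (69 : S) * x 0 * x 3 * x 9 + (20 : S) * x 0 * x 6 ^ 2 + (46 : S) * x 0 * x 6 * x 9 + (-180 : S) * x 6 ^ 2 * x 9 + (-504 : S) * x 6 * x 9 ^ 2 + (-207 : S) * x 9 ^ 3) * pderiv 0 F₄₄ +
      ((-60 : S) * x 3 ^ 2 * x 6 + (-138 : S) * x 3 ^ 2 * x 9 + (-40 : S) * x 3 * x 6 ^ 2 + (-92 : S) * x 3 * x 6 * x 9) * pderiv 3 F₄₄ +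
      ((90 : S) * x 3 ^ 2 * x 6 + (207 : S) * x 3 ^ 2 * x 9 + (90 : S) * x 3 * x 6 ^ 2 + (207 : S) * x 3 * x 6 * x 9 + (20 : S) * x 6 ^ 3 + (406 : S) * x 6 ^ 2 * x 9 + (1008 : S) * x 6 * x 9 ^ 2 + (414 : S) * x 9 ^ 3) * pderiv 6 F₄₄ +
      ((-40 : S) * x 6 ^ 2 * x 9 + (-752 : S) * x 6 * x 9 ^ 2 + (-918 : S) * x 9 ^ 3) * pderiv 9 F₄₄ := by
    rw [ex44_pderiv_0, ex44_pderiv_3, ex44_pderiv_6, ex44_pderiv_9]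
    ring
  rw [show (((414 : ℕ) : S)) = (414 : S) by norm_cast, key]
  exact Ideal.add_mem _ (Ideal.add_mem _ (Ideal.add_mem _
    (Ideal.mul_mem_left _ _ (pderiv_mem_jacobianIdeal _ _))
    (Ideal.mul_mem_left _ _ (pderiv_mem_jacobianIdeal _ _)))
    (Ideal.mul_mem_left _ _ (pderiv_mem_jacobianIdeal _ _)))
    (Ideal.mul_mem_left _ _ (pderiv_mem_jacobianIdeal _ _))

/-- `x_1^5 ∈ J^F` (certificate `414·x_1^5 = Σ h_u ∂_u F`, exact linear algebra). [cite: Kloosterman2025, Example 4.4 ("X = V(f) is smooth")] -/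
theorem ex44_X1_pow_mem [CharZero K] : (X 1 : S) ^ 5 ∈ jacobianIdeal F₄₄ := by
  refine mem_of_natCast_mul_mem 414 (Nat.cast_ne_zero.mpr (by norm_num)) ?_
  have key : (414 : S) * x 1 ^ 5 =
      ((-414 : S) * x 1 ^ 3 + (207 : S) * x 1 ^ 2 * x 4 + (621 : S) * x 1 ^ 2 * x 7 + (-138 : S) * x 1 * x 4 ^ 2 + (-303 : S) * x 1 * x 4 * x 7 + (-593 : S) * x 1 * x 7 ^ 2 + (-184 : S) * x 1 * x 7 * x 10 + (-1632 : S) * x 7 ^ 2 * x 10 + (-816 : S) * x 7 * x 10 ^ 2) * pderiv 1 F₄₄ +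
      ((414 : S) * x 1 ^ 3 + (-414 : S) * x 1 ^ 2 * x 7 + (414 : S) * x 1 * x 7 ^ 2 + (69 : S) * x 4 ^ 3 + (-222 : S) * x 4 ^ 2 * x 7 + (151 : S) * x 4 * x 7 ^ 2 + (92 : S) * x 4 * x 7 * x 10 + (-414 : S) * x 7 ^ 3) * pderiv 4 F₄₄ +
      ((-414 : S) * x 1 * x 7 ^ 2 + (276 : S) * x 1 * x 7 * x 10 + (816 : S) * x 4 ^ 2 * x 7 + (816 : S) * x 4 * x 7 ^ 2 + (1270 : S) * x 7 ^ 3 + (3356 : S) * x 7 ^ 2 * x 10 + (1632 : S) * x 7 * x 10 ^ 2) * pderiv 7 F₄₄ +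
      ((414 : S) * x 1 * x 7 ^ 2 + (-138 : S) * x 1 * x 10 ^ 2 + (-2540 : S) * x 7 ^ 2 * x 10 + (-2902 : S) * x 7 * x 10 ^ 2 + (-816 : S) * x 10 ^ 3) * pderiv 10 F₄₄ := by
    rw [ex44_pderiv_1, ex44_pderiv_4, ex44_pderiv_7, ex44_pderiv_10]
    ring
  rw [show (((414 : ℕ) : S)) = (414 : S) by norm_cast, key]
  exact Ideal.add_mem _ (Ideal.add_mem _ (Ideal.add_mem _
    (Ideal.mul_mem_left _ _ (pderiv_mem_jacobianIdeal _ _))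
    (Ideal.mul_mem_left _ _ (pderiv_mem_jacobianIdeal _ _)))
    (Ideal.mul_mem_left _ _ (pderiv_mem_jacobianIdeal _ _)))
    (Ideal.mul_mem_left _ _ (pderiv_mem_jacobianIdeal _ _))

/-- `x_4^5 ∈ J^F` (certificate `207·x_4^5 = Σ h_u ∂_u F`, exact linear algebra). [cite: Kloosterman2025, Example 4.4 ("X = V(f) is smooth")] -/
theorem ex44_X4_pow_mem [CharZero K] : (X 4 : S) ^ 5 ∈ jacobianIdeal F₄₄ := by
  refine mem_of_natCast_mul_mem 207 (Nat.cast_ne_zero.mpr (by norm_num)) ?_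
  have key : (207 : S) * x 4 ^ 5 =
      ((138 : S) * x 1 * x 4 ^ 2 + (-48 : S) * x 1 * x 4 * x 7 + (221 : S) * x 1 * x 7 ^ 2 + (46 : S) * x 1 * x 7 * x 10 + (207 : S) * x 4 ^ 3 + (-207 : S) * x 4 ^ 2 * x 7 + (207 : S) * x 4 * x 7 ^ 2 + (-207 : S) * x 7 ^ 3 + (-816 : S) * x 7 ^ 2 * x 10 + (-408 : S) * x 7 * x 10 ^ 2) * pderiv 1 F₄₄ +
      ((-276 : S) * x 4 ^ 3 + (96 : S) * x 4 ^ 2 * x 7 + (-442 : S) * x 4 * x 7 ^ 2 + (-92 : S) * x 4 * x 7 * x 10) * pderiv 4 F₄₄ +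
      ((408 : S) * x 4 ^ 2 * x 7 + (201 : S) * x 4 * x 7 ^ 2 + (138 : S) * x 4 * x 7 * x 10 + (635 : S) * x 7 ^ 3 + (1678 : S) * x 7 ^ 2 * x 10 + (816 : S) * x 7 * x 10 ^ 2) * pderiv 7 F₄₄ +
      ((207 : S) * x 4 * x 7 ^ 2 + (-69 : S) * x 4 * x 10 ^ 2 + (-1270 : S) * x 7 ^ 2 * x 10 + (-1451 : S) * x 7 * x 10 ^ 2 + (-408 : S) * x 10 ^ 3) * pderiv 10 F₄₄ := by
    rw [ex44_pderiv_1, ex44_pderiv_4, ex44_pderiv_7, ex44_pderiv_10]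
    ring
  rw [show (((207 : ℕ) : S)) = (207 : S) by norm_cast, key]
  exact Ideal.add_mem _ (Ideal.add_mem _ (Ideal.add_mem _
    (Ideal.mul_mem_left _ _ (pderiv_mem_jacobianIdeal _ _))
    (Ideal.mul_mem_left _ _ (pderiv_mem_jacobianIdeal _ _)))
    (Ideal.mul_mem_left _ _ (pderiv_mem_jacobianIdeal _ _)))
    (Ideal.mul_mem_left _ _ (pderiv_mem_jacobianIdeal _ _))

/-- `x_7^5 ∈ J^F` (certificate `69·x_7^5 = Σ h_u ∂_u F`, exact linear algebra). [cite: Kloosterman2025, Example 4.4 ("X = V(f) is smooth")] -/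
theorem ex44_X7_pow_mem [CharZero K] : (X 7 : S) ^ 5 ∈ jacobianIdeal F₄₄ := by
  refine mem_of_natCast_mul_mem 69 (Nat.cast_ne_zero.mpr (by norm_num)) ?_
  have key : (69 : S) * x 7 ^ 5 =
      ((24 : S) * x 1 * x 4 * x 7 + (16 : S) * x 1 * x 7 ^ 2 + (-144 : S) * x 7 ^ 2 * x 10 + (-72 : S) * x 7 * x 10 ^ 2) * pderiv 1 F₄₄ +
      ((-48 : S) * x 4 ^ 2 * x 7 + (-32 : S) * x 4 * x 7 ^ 2) * pderiv 4 F₄₄ +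
      ((72 : S) * x 4 ^ 2 * x 7 + (72 : S) * x 4 * x 7 ^ 2 + (16 : S) * x 7 ^ 3 + (288 : S) * x 7 ^ 2 * x 10 + (144 : S) * x 7 * x 10 ^ 2) * pderiv 7 F₄₄ +
      ((69 : S) * x 7 ^ 3 + (-170 : S) * x 7 ^ 2 * x 10 + (-252 : S) * x 7 * x 10 ^ 2 + (-72 : S) * x 10 ^ 3) * pderiv 10 F₄₄ := by
    rw [ex44_pderiv_1, ex44_pderiv_4, ex44_pderiv_7, ex44_pderiv_10]
    ring
  rw [show (((69 : ℕ) : S)) = (69 : S) by norm_cast, key]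
  exact Ideal.add_mem _ (Ideal.add_mem _ (Ideal.add_mem _
    (Ideal.mul_mem_left _ _ (pderiv_mem_jacobianIdeal _ _))
    (Ideal.mul_mem_left _ _ (pderiv_mem_jacobianIdeal _ _)))
    (Ideal.mul_mem_left _ _ (pderiv_mem_jacobianIdeal _ _)))
    (Ideal.mul_mem_left _ _ (pderiv_mem_jacobianIdeal _ _))

/-- `x_10^5 ∈ J^F` (certificate `414·x_10^5 = Σ h_u ∂_u F`, exact linear algebra). [cite: Kloosterman2025, Example 4.4 ("X = V(f) is smooth")] -/
theorem ex44_X10_pow_mem [CharZero K] : (X 10 : S) ^ 5 ∈ jacobianIdeal F₄₄ := by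
  refine mem_of_natCast_mul_mem 414 (Nat.cast_ne_zero.mpr (by norm_num)) ?_
  have key : (414 : S) * x 10 ^ 5 =
      ((30 : S) * x 1 * x 4 * x 7 + (69 : S) * x 1 * x 4 * x 10 + (20 : S) * x 1 * x 7 ^ 2 + (46 : S) * x 1 * x 7 * x 10 + (-180 : S) * x 7 ^ 2 * x 10 + (-504 : S) * x 7 * x 10 ^ 2 + (-207 : S) * x 10 ^ 3) * pderiv 1 F₄₄ +
      ((-60 : S) * x 4 ^ 2 * x 7 + (-138 : S) * x 4 ^ 2 * x 10 + (-40 : S) * x 4 * x 7 ^ 2 + (-92 : S) * x 4 * x 7 * x 10) * pderiv 4 F₄₄ +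
      ((90 : S) * x 4 ^ 2 * x 7 + (207 : S) * x 4 ^ 2 * x 10 + (90 : S) * x 4 * x 7 ^ 2 + (207 : S) * x 4 * x 7 * x 10 + (20 : S) * x 7 ^ 3 + (406 : S) * x 7 ^ 2 * x 10 + (1008 : S) * x 7 * x 10 ^ 2 + (414 : S) * x 10 ^ 3) * pderiv 7 F₄₄ +
      ((-40 : S) * x 7 ^ 2 * x 10 + (-752 : S) * x 7 * x 10 ^ 2 + (-918 : S) * x 10 ^ 3) * pderiv 10 F₄₄ := by
    rw [ex44_pderiv_1, ex44_pderiv_4, ex44_pderiv_7, ex44_pderiv_10]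
    ring
  rw [show (((414 : ℕ) : S)) = (414 : S) by norm_cast, key]
  exact Ideal.add_mem _ (Ideal.add_mem _ (Ideal.add_mem _
    (Ideal.mul_mem_left _ _ (pderiv_mem_jacobianIdeal _ _))
    (Ideal.mul_mem_left _ _ (pderiv_mem_jacobianIdeal _ _)))
    (Ideal.mul_mem_left _ _ (pderiv_mem_jacobianIdeal _ _)))
    (Ideal.mul_mem_left _ _ (pderiv_mem_jacobianIdeal _ _))

/-- `x_2^5 ∈ J^F` (certificate `414·x_2^5 = Σ h_u ∂_u F`, exact linear algebra). [cite: Kloosterman2025, Example 4.4 ("X = V(f) is smooth")] -/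
theorem ex44_X2_pow_mem [CharZero K] : (X 2 : S) ^ 5 ∈ jacobianIdeal F₄₄ := by
  refine mem_of_natCast_mul_mem 414 (Nat.cast_ne_zero.mpr (by norm_num)) ?_
  have key : (414 : S) * x 2 ^ 5 =
      ((-414 : S) * x 2 ^ 3 + (207 : S) * x 2 ^ 2 * x 5 + (621 : S) * x 2 ^ 2 * x 8 + (-138 : S) * x 2 * x 5 ^ 2 + (-303 : S) * x 2 * x 5 * x 8 + (-593 : S) * x 2 * x 8 ^ 2 + (-184 : S) * x 2 * x 8 * x 11 + (-1632 : S) * x 8 ^ 2 * x 11 + (-816 : S) * x 8 * x 11 ^ 2) * pderiv 2 F₄₄ +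
      ((414 : S) * x 2 ^ 3 + (-414 : S) * x 2 ^ 2 * x 8 + (414 : S) * x 2 * x 8 ^ 2 + (69 : S) * x 5 ^ 3 + (-222 : S) * x 5 ^ 2 * x 8 + (151 : S) * x 5 * x 8 ^ 2 + (92 : S) * x 5 * x 8 * x 11 + (-414 : S) * x 8 ^ 3) * pderiv 5 F₄₄ +
      ((-414 : S) * x 2 * x 8 ^ 2 + (276 : S) * x 2 * x 8 * x 11 + (816 : S) * x 5 ^ 2 * x 8 + (816 : S) * x 5 * x 8 ^ 2 + (1270 : S) * x 8 ^ 3 + (3356 : S) * x 8 ^ 2 * x 11 + (1632 : S) * x 8 * x 11 ^ 2) * pderiv 8 F₄₄ +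
      ((414 : S) * x 2 * x 8 ^ 2 + (-138 : S) * x 2 * x 11 ^ 2 + (-2540 : S) * x 8 ^ 2 * x 11 + (-2902 : S) * x 8 * x 11 ^ 2 + (-816 : S) * x 11 ^ 3) * pderiv 11 F₄₄ := by
    rw [ex44_pderiv_2, ex44_pderiv_5, ex44_pderiv_8, ex44_pderiv_11]
    ring
  rw [show (((414 : ℕ) : S)) = (414 : S) by norm_cast, key]
  exact Ideal.add_mem _ (Ideal.add_mem _ (Ideal.add_mem _
    (Ideal.mul_mem_left _ _ (pderiv_mem_jacobianIdeal _ _))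
    (Ideal.mul_mem_left _ _ (pderiv_mem_jacobianIdeal _ _)))
    (Ideal.mul_mem_left _ _ (pderiv_mem_jacobianIdeal _ _)))
    (Ideal.mul_mem_left _ _ (pderiv_mem_jacobianIdeal _ _))

/-- `x_5^5 ∈ J^F` (certificate `207·x_5^5 = Σ h_u ∂_u F`, exact linear algebra). [cite: Kloosterman2025, Example 4.4 ("X = V(f) is smooth")] -/
theorem ex44_X5_pow_mem [CharZero K] : (X 5 : S) ^ 5 ∈ jacobianIdeal F₄₄ := by
  refine mem_of_natCast_mul_mem 207 (Nat.cast_ne_zero.mpr (by norm_num)) ?_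
  have key : (207 : S) * x 5 ^ 5 =
      ((138 : S) * x 2 * x 5 ^ 2 + (-48 : S) * x 2 * x 5 * x 8 + (221 : S) * x 2 * x 8 ^ 2 + (46 : S) * x 2 * x 8 * x 11 + (207 : S) * x 5 ^ 3 + (-207 : S) * x 5 ^ 2 * x 8 + (207 : S) * x 5 * x 8 ^ 2 + (-207 : S) * x 8 ^ 3 + (-816 : S) * x 8 ^ 2 * x 11 + (-408 : S) * x 8 * x 11 ^ 2) * pderiv 2 F₄₄ +
      ((-276 : S) * x 5 ^ 3 + (96 : S) * x 5 ^ 2 * x 8 + (-442 : S) * x 5 * x 8 ^ 2 + (-92 : S) * x 5 * x 8 * x 11) * pderiv 5 F₄₄ +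
      ((408 : S) * x 5 ^ 2 * x 8 + (201 : S) * x 5 * x 8 ^ 2 + (138 : S) * x 5 * x 8 * x 11 + (635 : S) * x 8 ^ 3 + (1678 : S) * x 8 ^ 2 * x 11 + (816 : S) * x 8 * x 11 ^ 2) * pderiv 8 F₄₄ +
      ((207 : S) * x 5 * x 8 ^ 2 + (-69 : S) * x 5 * x 11 ^ 2 + (-1270 : S) * x 8 ^ 2 * x 11 + (-1451 : S) * x 8 * x 11 ^ 2 + (-408 : S) * x 11 ^ 3) * pderiv 11 F₄₄ := by
    rw [ex44_pderiv_2, ex44_pderiv_5, ex44_pderiv_8, ex44_pderiv_11]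
    ring
  rw [show (((207 : ℕ) : S)) = (207 : S) by norm_cast, key]
  exact Ideal.add_mem _ (Ideal.add_mem _ (Ideal.add_mem _
    (Ideal.mul_mem_left _ _ (pderiv_mem_jacobianIdeal _ _))
    (Ideal.mul_mem_left _ _ (pderiv_mem_jacobianIdeal _ _)))
    (Ideal.mul_mem_left _ _ (pderiv_mem_jacobianIdeal _ _)))
    (Ideal.mul_mem_left _ _ (pderiv_mem_jacobianIdeal _ _))

/-- `x_8^5 ∈ J^F` (certificate `69·x_8^5 = Σ h_u ∂_u F`, exact linear algebra). [cite: Kloosterman2025, Example 4.4 ("X = V(f) is smooth")] -/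
theorem ex44_X8_pow_mem [CharZero K] : (X 8 : S) ^ 5 ∈ jacobianIdeal F₄₄ := by
  refine mem_of_natCast_mul_mem 69 (Nat.cast_ne_zero.mpr (by norm_num)) ?_
  have key : (69 : S) * x 8 ^ 5 =
      ((24 : S) * x 2 * x 5 * x 8 + (16 : S) * x 2 * x 8 ^ 2 + (-144 : S) * x 8 ^ 2 * x 11 + (-72 : S) * x 8 * x 11 ^ 2) * pderiv 2 F₄₄ +
      ((-48 : S) * x 5 ^ 2 * x 8 + (-32 : S) * x 5 * x 8 ^ 2) * pderiv 5 F₄₄ +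
      ((72 : S) * x 5 ^ 2 * x 8 + (72 : S) * x 5 * x 8 ^ 2 + (16 : S) * x 8 ^ 3 + (288 : S) * x 8 ^ 2 * x 11 + (144 : S) * x 8 * x 11 ^ 2) * pderiv 8 F₄₄ +
      ((69 : S) * x 8 ^ 3 + (-170 : S) * x 8 ^ 2 * x 11 + (-252 : S) * x 8 * x 11 ^ 2 + (-72 : S) * x 11 ^ 3) * pderiv 11 F₄₄ := by
    rw [ex44_pderiv_2, ex44_pderiv_5, ex44_pderiv_8, ex44_pderiv_11]
    ring
  rw [show (((69 : ℕ) : S)) = (69 : S) by norm_cast, key]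
  exact Ideal.add_mem _ (Ideal.add_mem _ (Ideal.add_mem _
    (Ideal.mul_mem_left _ _ (pderiv_mem_jacobianIdeal _ _))
    (Ideal.mul_mem_left _ _ (pderiv_mem_jacobianIdeal _ _)))
    (Ideal.mul_mem_left _ _ (pderiv_mem_jacobianIdeal _ _)))
    (Ideal.mul_mem_left _ _ (pderiv_mem_jacobianIdeal _ _))

/-- `x_11^5 ∈ J^F` (certificate `414·x_11^5 = Σ h_u ∂_u F`, exact linear algebra). [cite: Kloosterman2025, Example 4.4 ("X = V(f) is smooth")] -/
theorem ex44_X11_pow_mem [CharZero K] : (X 11 : S) ^ 5 ∈ jacobianIdeal F₄₄ := by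
  refine mem_of_natCast_mul_mem 414 (Nat.cast_ne_zero.mpr (by norm_num)) ?_
  have key : (414 : S) * x 11 ^ 5 =
      ((30 : S) * x 2 * x 5 * x 8 + (69 : S) * x 2 * x 5 * x 11 + (20 : S) * x 2 * x 8 ^ 2 + (46 : S) * x 2 * x 8 * x 11 + (-180 : S) * x 8 ^ 2 * x 11 + (-504 : S) * x 8 * x 11 ^ 2 + (-207 : S) * x 11 ^ 3) * pderiv 2 F₄₄ +
      ((-60 : S) * x 5 ^ 2 * x 8 + (-138 : S) * x 5 ^ 2 * x 11 + (-40 : S) * x 5 * x 8 ^ 2 + (-92 : S) * x 5 * x 8 * x 11) * pderiv 5 F₄₄ +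
      ((90 : S) * x 5 ^ 2 * x 8 + (207 : S) * x 5 ^ 2 * x 11 + (90 : S) * x 5 * x 8 ^ 2 + (207 : S) * x 5 * x 8 * x 11 + (20 : S) * x 8 ^ 3 + (406 : S) * x 8 ^ 2 * x 11 + (1008 : S) * x 8 * x 11 ^ 2 + (414 : S) * x 11 ^ 3) * pderiv 8 F₄₄ +
      ((-40 : S) * x 8 ^ 2 * x 11 + (-752 : S) * x 8 * x 11 ^ 2 + (-918 : S) * x 11 ^ 3) * pderiv 11 F₄₄ := by
    rw [ex44_pderiv_2, ex44_pderiv_5, ex44_pderiv_8, ex44_pderiv_11]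
    ring
  rw [show (((414 : ℕ) : S)) = (414 : S) by norm_cast, key]
  exact Ideal.add_mem _ (Ideal.add_mem _ (Ideal.add_mem _
    (Ideal.mul_mem_left _ _ (pderiv_mem_jacobianIdeal _ _))
    (Ideal.mul_mem_left _ _ (pderiv_mem_jacobianIdeal _ _)))
    (Ideal.mul_mem_left _ _ (pderiv_mem_jacobianIdeal _ _)))
    (Ideal.mul_mem_left _ _ (pderiv_mem_jacobianIdeal _ _))


/-- **`X = V(f)` is smooth** (Example 4.4): `x_l^5 ∈ J^f` for all twelve variables. [cite: Kloosterman2025, Example 4.4] -/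
theorem ex44_X_pow_mem [CharZero K] : ∀ l, (X l : S) ^ 5 ∈ jacobianIdeal F₄₄ := by
  intro l
  fin_cases l
  exacts [ex44_X0_pow_mem, ex44_X1_pow_mem, ex44_X2_pow_mem, ex44_X3_pow_mem, ex44_X4_pow_mem,
    ex44_X5_pow_mem, ex44_X6_pow_mem, ex44_X7_pow_mem, ex44_X8_pow_mem, ex44_X9_pow_mem, ex44_X10_pow_mem,
    ex44_X11_pow_mem]

variable (κ₀ : Fin 3 ⊕ Fin 3 ≃ Fin (5 + 1))

local notation "I₁⁴⁴" => (Ideal.span (Set.range (plane₁Gens κ₀ (ex44GA (K := K)) ex44GC)) ⊔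
  Ideal.span (Set.range (plane₁Cofs κ₀ (ex44H (K := K)) ex44Q ex44P)))
local notation "I₂⁴⁴" => (Ideal.span (Set.range (plane₂Gens κ₀ (ex44H (K := K)) ex44GC)) ⊔
  Ideal.span (Set.range (plane₂Cofs κ₀ (ex44GA (K := K)) ex44Q ex44P)))

/-- **The colon element of Example 4.4**: `u = (x_0+x_6)(x_1+x_7)(x_2+x_8) ∈ (I₂ : I₁)`
(`x_iu = (⋯)·x_iQ_{i,i+3} − x_{i+3}·(⋯)` for `i = 0,1,2`; the other generators of `I₁` lie in `I₂`).
[cite: Kloosterman2025, Example 4.4] -/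
theorem ex44_u_mem_colon : (x 0 + x 6) * (x 1 + x 7) * (x 2 + x 8) ∈ (I₂⁴⁴).colon ((I₁⁴⁴ : Ideal S) : Set S) := by
  refine mem_colon_of_le_colon_singleton (plane₁_le κ₀ ex44GA ex44H ex44GC ex44Q ex44P ?_ ?_ ?_ ?_)
  · have h0 : ex44GA (K := K) 0 • ((x 0 + x 6) * (x 1 + x 7) * (x 2 + x 8)) ∈ I₂⁴⁴ := by
      have e : ex44GA (K := K) 0 • ((x 0 + x 6) * (x 1 + x 7) * (x 2 + x 8)) =
          ((x 1 + x 7) * (x 2 + x 8)) * (∑ i, ex44GA i * ex44Q i 0) - (x 0 * (x 1 + x 7) * (x 2 + x 8)) * ex44H 0 := by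
        simp only [smul_eq_mul, Fin.sum_univ_three, ex44GA_0, ex44GA_1, ex44GA_2, ex44Q_00, ex44Q_10, ex44Q_20, ex44H_0]
        ring
      rw [e]
      exact sub_mem (Ideal.mul_mem_left _ _ (sum_mem_plane₂ κ₀ ex44GA ex44H ex44GC ex44Q ex44P 0))
        (Ideal.mul_mem_left _ _ (h_mem_plane₂ κ₀ ex44GA ex44H ex44GC ex44Q ex44P 0))
    have h1 : ex44GA (K := K) 1 • ((x 0 + x 6) * (x 1 + x 7) * (x 2 + x 8)) ∈ I₂⁴⁴ := by
      have e : ex44GA (K := K) 1 • ((x 0 + x 6) * (x 1 + x 7) * (x 2 + x 8)) =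
          ((x 0 + x 6) * (x 2 + x 8)) * (∑ i, ex44GA i * ex44Q i 1) - ((x 0 + x 6) * x 1 * (x 2 + x 8)) * ex44H 1 := by
        simp only [smul_eq_mul, Fin.sum_univ_three, ex44GA_0, ex44GA_1, ex44GA_2, ex44Q_01, ex44Q_11, ex44Q_21, ex44H_1]
        ring
      rw [e]
      exact sub_mem (Ideal.mul_mem_left _ _ (sum_mem_plane₂ κ₀ ex44GA ex44H ex44GC ex44Q ex44P 1))
        (Ideal.mul_mem_left _ _ (h_mem_plane₂ κ₀ ex44GA ex44H ex44GC ex44Q ex44P 1))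
    have h2 : ex44GA (K := K) 2 • ((x 0 + x 6) * (x 1 + x 7) * (x 2 + x 8)) ∈ I₂⁴⁴ := by
      have e : ex44GA (K := K) 2 • ((x 0 + x 6) * (x 1 + x 7) * (x 2 + x 8)) =
          ((x 0 + x 6) * (x 1 + x 7)) * (∑ i, ex44GA i * ex44Q i 2) - ((x 0 + x 6) * (x 1 + x 7) * x 2) * ex44H 2 := by
        simp only [smul_eq_mul, Fin.sum_univ_three, ex44GA_0, ex44GA_1, ex44GA_2, ex44Q_02, ex44Q_12, ex44Q_22, ex44H_2]
        ring
      rw [e]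
      exact sub_mem (Ideal.mul_mem_left _ _ (sum_mem_plane₂ κ₀ ex44GA ex44H ex44GC ex44Q ex44P 2))
        (Ideal.mul_mem_left _ _ (h_mem_plane₂ κ₀ ex44GA ex44H ex44GC ex44Q ex44P 2))
    intro i
    fin_cases i
    exacts [Submodule.mem_colon_singleton.mpr h0, Submodule.mem_colon_singleton.mpr h1,
      Submodule.mem_colon_singleton.mpr h2]
  · intro m
    refine Submodule.mem_colon_singleton.mpr ?_
    rw [smul_eq_mul]
    exact Ideal.mul_mem_right _ _ (gC_mem_plane₂ κ₀ ex44GA ex44H ex44GC ex44Q ex44P m)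
  · intro i
    refine Submodule.mem_colon_singleton.mpr ?_
    rw [smul_eq_mul]
    exact Ideal.mul_mem_right _ _
      (Ideal.sum_mem _ fun j _ => Ideal.mul_mem_right _ _ (h_mem_plane₂ κ₀ ex44GA ex44H ex44GC ex44Q ex44P j))
  · intro m
    refine Submodule.mem_colon_singleton.mpr ?_
    rw [smul_eq_mul]
    exact Ideal.mul_mem_right _ _ (P_mem_plane₂ κ₀ ex44GA ex44H ex44GC ex44Q ex44P m)

/-- **`S_3 ⊆ I₁ + (I₂ : I₁)` for Example 4.4**: every monomial of degree `3` is divisible by one of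
`x_0,x_1,x_2,x_9,x_10,x_11 ∈ I₁`, `x_3,x_4,x_5 ∈ I₂`, `x_{6+i}² = P_{9+i} − x_{6+i}·x_{9+i} ∈ I₁`, or equals
`x_6x_7x_8 ≡ u (mod I₁)`. [cite: Kloosterman2025, Example 4.4] -/
theorem ex44_monomial_mem {s : Fin (2 * 5 + 2) →₀ ℕ} (hs : s.degree = 3) :
    monomial s (1 : K) ∈ I₁⁴⁴ ⊔ (I₂⁴⁴).colon ((I₁⁴⁴ : Ideal S) : Set S) := by
  have hgA : ∀ i, ex44GA i ∈ I₁⁴⁴ ⊔ (I₂⁴⁴).colon ((I₁⁴⁴ : Ideal S) : Set S) := fun i =>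
    Ideal.mem_sup_left (gA_mem_plane₁ κ₀ ex44GA ex44H ex44GC ex44Q ex44P i)
  have hgC : ∀ m, ex44GC m ∈ I₁⁴⁴ ⊔ (I₂⁴⁴).colon ((I₁⁴⁴ : Ideal S) : Set S) := fun m =>
    Ideal.mem_sup_left (gC_mem_plane₁ κ₀ ex44GA ex44H ex44GC ex44Q ex44P m)
  have hh : ∀ j, ex44H j ∈ I₁⁴⁴ ⊔ (I₂⁴⁴).colon ((I₁⁴⁴ : Ideal S) : Set S) := fun j =>
    Ideal.mem_sup_right (le_colon_set _ _ (h_mem_plane₂ κ₀ ex44GA ex44H ex44GC ex44Q ex44P j))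
  have hx6 : x 6 ^ 2 ∈ I₁⁴⁴ ⊔ (I₂⁴⁴).colon ((I₁⁴⁴ : Ideal S) : Set S) := by
    have e : x 6 ^ 2 = ex44P 0 - x 6 * ex44GC 0 := by simp only [ex44P_0, ex44GC_0]; ring
    rw [e]
    exact Ideal.mem_sup_left (sub_mem (P_mem_plane₁ κ₀ ex44GA ex44H ex44GC ex44Q ex44P 0)
      (Ideal.mul_mem_left _ _ (gC_mem_plane₁ κ₀ ex44GA ex44H ex44GC ex44Q ex44P 0)))
  have hx7 : x 7 ^ 2 ∈ I₁⁴⁴ ⊔ (I₂⁴⁴).colon ((I₁⁴⁴ : Ideal S) : Set S) := by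
    have e : x 7 ^ 2 = ex44P 1 - x 7 * ex44GC 1 := by simp only [ex44P_1, ex44GC_1]; ring
    rw [e]
    exact Ideal.mem_sup_left (sub_mem (P_mem_plane₁ κ₀ ex44GA ex44H ex44GC ex44Q ex44P 1)
      (Ideal.mul_mem_left _ _ (gC_mem_plane₁ κ₀ ex44GA ex44H ex44GC ex44Q ex44P 1)))
  have hx8 : x 8 ^ 2 ∈ I₁⁴⁴ ⊔ (I₂⁴⁴).colon ((I₁⁴⁴ : Ideal S) : Set S) := by
    have e : x 8 ^ 2 = ex44P 2 - x 8 * ex44GC 2 := by simp only [ex44P_2, ex44GC_2]; ring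
    rw [e]
    exact Ideal.mem_sup_left (sub_mem (P_mem_plane₁ κ₀ ex44GA ex44H ex44GC ex44Q ex44P 2)
      (Ideal.mul_mem_left _ _ (gC_mem_plane₁ κ₀ ex44GA ex44H ex44GC ex44Q ex44P 2)))
  have hx678 : x 6 * x 7 * x 8 ∈ I₁⁴⁴ ⊔ (I₂⁴⁴).colon ((I₁⁴⁴ : Ideal S) : Set S) := by
    have e : x 6 * x 7 * x 8 = (x 0 + x 6) * (x 1 + x 7) * (x 2 + x 8) -
        (x 1 * x 2 + x 1 * x 8 + x 7 * x 2 + x 7 * x 8) * ex44GA 0 - (x 6 * x 2 + x 6 * x 8) * ex44GA 1 -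
          (x 6 * x 7) * ex44GA 2 := by
      simp only [ex44GA_0, ex44GA_1, ex44GA_2]; ring
    rw [e]
    exact sub_mem (sub_mem (sub_mem (Ideal.mem_sup_right (ex44_u_mem_colon κ₀)) (Ideal.mul_mem_left _ _ (hgA 0)))
      (Ideal.mul_mem_left _ _ (hgA 1))) (Ideal.mul_mem_left _ _ (hgA 2))
  -- case analysis on the exponent vector
  have h12 : ∑ i, s i = s 0 + s 1 + s 2 + s 3 + s 4 + s 5 + s 6 + s 7 + s 8 + s 9 + s 10 + s 11 := by
    simp only [Fin.sum_univ_succ, Fin.sum_univ_zero, Fin.succ_zero_eq_one, Fin.reduceSucc, add_zero, add_assoc]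
  have hsum : s 0 + s 1 + s 2 + s 3 + s 4 + s 5 + s 6 + s 7 + s 8 + s 9 + s 10 + s 11 = 3 := by
    rw [← h12, ← Finsupp.degree_eq_sum]; exact hs
  by_cases h0 : s 0 ≠ 0; · exact monomial_mem_of_X_mem (hgA 0) h0
  by_cases h1 : s 1 ≠ 0; · exact monomial_mem_of_X_mem (hgA 1) h1
  by_cases h2 : s 2 ≠ 0; · exact monomial_mem_of_X_mem (hgA 2) h2
  by_cases h3 : s 3 ≠ 0; · exact monomial_mem_of_X_mem (hh 0) h3
  by_cases h4 : s 4 ≠ 0; · exact monomial_mem_of_X_mem (hh 1) h4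
  by_cases h5 : s 5 ≠ 0; · exact monomial_mem_of_X_mem (hh 2) h5
  by_cases h9 : s 9 ≠ 0; · exact monomial_mem_of_X_mem (hgC 0) h9
  by_cases h10 : s 10 ≠ 0; · exact monomial_mem_of_X_mem (hgC 1) h10
  by_cases h11 : s 11 ≠ 0; · exact monomial_mem_of_X_mem (hgC 2) h11
  by_cases h6 : 2 ≤ s 6; · exact monomial_mem_of_X_pow_mem hx6 h6
  by_cases h7 : 2 ≤ s 7; · exact monomial_mem_of_X_pow_mem hx7 h7
  by_cases h8 : 2 ≤ s 8; · exact monomial_mem_of_X_pow_mem hx8 h8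
  push Not at h0 h1 h2 h3 h4 h5 h9 h10 h11 h6 h7 h8
  have e6 : s 6 = 1 := by omega
  have e7 : s 7 = 1 := by omega
  have e8 : s 8 = 1 := by omega
  have hs' : s = Finsupp.single 6 1 + Finsupp.single 7 1 + Finsupp.single 8 1 := by
    ext i
    fin_cases i <;> simp (config := { decide := true }) [h0, h1, h2, h3, h4, h5, e6, e7, e8, h9, h10, h11]
  have emon : monomial (Finsupp.single 6 1 + Finsupp.single 7 1 + Finsupp.single 8 1) (1 : K) = x 6 * x 7 * x 8 := by
    rw [← pow_one (x 6), ← pow_one (x 7), ← pow_one (x 8), X_pow_eq_monomial, X_pow_eq_monomial, X_pow_eq_monomial,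
      monomial_mul, monomial_mul, mul_one, mul_one]
  rw [hs', emon]
  exact hx678

/-- **Example 4.4, the base of the induction** ("the rank … turns out to be maximal"): for every socle
functional `ℓ₀` of `J^f`, the exceptional sets of the two cycle functionals are finite for `a' ≤ 3`, empty for
`a' < 3`, and `#E_3 ≤ h_{I₁+I₂}(3) = 1`. [cite: Kloosterman2025, Example 4.4, Proposition 4.6] -/
theorem ex44_base [CharZero K] {ℓ₀ : S →ₗ[K] K}
    (hℓ₀ : ∀ p, ℓ₀ (homogeneousComponent ((2 * 5 + 2) * (3 - 2)) p) = ℓ₀ p) (hJ₀ : annIdeal ℓ₀ = jacobianIdeal F₄₄) :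
    (∀ a' ≤ 3, (excessSet (ciCycleFunctional ℓ₀ (plane₁Gens κ₀ ex44GA ex44GC) (plane₁Cofs κ₀ ex44H ex44Q ex44P))
        (ciCycleFunctional ℓ₀ (plane₂Gens κ₀ ex44H ex44GC) (plane₂Cofs κ₀ ex44GA ex44Q ex44P)) a').Finite) ∧
    (∀ a' < 3, excessSet (ciCycleFunctional ℓ₀ (plane₁Gens κ₀ ex44GA ex44GC) (plane₁Cofs κ₀ ex44H ex44Q ex44P))
        (ciCycleFunctional ℓ₀ (plane₂Gens κ₀ ex44H ex44GC) (plane₂Cofs κ₀ ex44GA ex44Q ex44P)) a' = ∅) ∧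
    (excessSet (ciCycleFunctional ℓ₀ (plane₁Gens κ₀ ex44GA ex44GC) (plane₁Cofs κ₀ ex44H ex44Q ex44P))
        (ciCycleFunctional ℓ₀ (plane₂Gens κ₀ ex44H ex44GC) (plane₂Cofs κ₀ ex44GA ex44Q ex44P)) 3).ncard ≤ 1 := by
  have hd : 2 ≤ 3 := by norm_num
  have hN : 0 < 5 := by norm_num
  set ℓ₁ := ciCycleFunctional ℓ₀ (plane₁Gens κ₀ ex44GA ex44GC) (plane₁Cofs κ₀ ex44H ex44Q ex44P) with hℓ₁
  set ℓ₂ := ciCycleFunctional ℓ₀ (plane₂Gens κ₀ ex44H ex44GC) (plane₂Cofs κ₀ ex44GA ex44Q ex44P) with hℓ₂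
  have hXN₁ : ∀ l, (X l : S) ^ 5 ∈ jacobianIdeal (∑ i, plane₁Gens κ₀ ex44GA ex44GC i * plane₁Cofs κ₀ ex44H ex44Q ex44P i) := by
    rw [sum_plane₁Gens_mul_plane₁Cofs]; exact ex44_X_pow_mem
  have hJ₁ : annIdeal ℓ₀ = jacobianIdeal (∑ i, plane₁Gens κ₀ ex44GA ex44GC i * plane₁Cofs κ₀ ex44H ex44Q ex44P i) := by
    rw [sum_plane₁Gens_mul_plane₁Cofs]; exact hJ₀
  have hXN₂ : ∀ l, (X l : S) ^ 5 ∈ jacobianIdeal (∑ i, plane₂Gens κ₀ ex44H ex44GC i * plane₂Cofs κ₀ ex44GA ex44Q ex44P i) := by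
    rw [sum_plane₂Gens_mul_plane₂Cofs]; exact ex44_X_pow_mem
  have hJ₂ : annIdeal ℓ₀ = jacobianIdeal (∑ i, plane₂Gens κ₀ ex44H ex44GC i * plane₂Cofs κ₀ ex44GA ex44Q ex44P i) := by
    rw [sum_plane₂Gens_mul_plane₂Cofs]; exact hJ₀
  have hI₁ : annIdeal ℓ₁ = I₁⁴⁴ :=
    annIdeal_ciCycleFunctional (d := 3) _ _ (fun _ => 1) (fun _ => 3 - 1) (isHomogeneous_plane₁Gens κ₀ ex44_hgA ex44_hgC)
      (isHomogeneous_plane₁Cofs κ₀ hd ex44_hh ex44_hQ ex44_hP) (fun _ => Nat.one_pos) (fun _ => by omega)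
      (fun _ => by omega) hN hXN₁ hJ₁
  have hI₂ : annIdeal ℓ₂ = I₂⁴⁴ :=
    annIdeal_ciCycleFunctional (d := 3) _ _ (fun _ => 1) (fun _ => 3 - 1) (isHomogeneous_plane₂Gens κ₀ ex44_hh ex44_hgC)
      (isHomogeneous_plane₂Cofs κ₀ hd ex44_hgA ex44_hQ ex44_hP) (fun _ => Nat.one_pos) (fun _ => by omega)
      (fun _ => by omega) hN hXN₂ hJ₂
  have hc₁ : ∀ p, ℓ₁ (homogeneousComponent ((5 + 1) * (3 - 2)) p) = ℓ₁ p :=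
    ciCycleFunctional_homogeneousComponent _ _ (fun _ => 1) (fun _ => 3 - 1)
      (isHomogeneous_plane₁Gens κ₀ ex44_hgA ex44_hgC) (isHomogeneous_plane₁Cofs κ₀ hd ex44_hh ex44_hQ ex44_hP)
      (fun _ => Nat.one_pos) (fun _ => by omega) (fun _ => by omega) hℓ₀
  have hc₂ : ∀ p, ℓ₂ (homogeneousComponent ((5 + 1) * (3 - 2)) p) = ℓ₂ p :=
    ciCycleFunctional_homogeneousComponent _ _ (fun _ => 1) (fun _ => 3 - 1)
      (isHomogeneous_plane₂Gens κ₀ ex44_hh ex44_hgC) (isHomogeneous_plane₂Cofs κ₀ hd ex44_hgA ex44_hQ ex44_hP)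
      (fun _ => Nat.one_pos) (fun _ => by omega) (fun _ => by omega) hℓ₀
  have hP3 : ∀ v : S, v.IsHomogeneous 3 → v ∈ annIdeal ℓ₁ → (∀ g ∈ annIdeal ℓ₁, v * g ∈ annIdeal ℓ₂) →
      v ∈ annIdeal ℓ₂ := by
    refine colonCriterion_of_forall_mem_sup_colon hc₂ (a := 3) (b := 3) (by norm_num) fun w hw => ?_
    rw [hI₁, hI₂]
    exact mem_of_forall_monomial_mem hw fun s hs => ex44_monomial_mem κ₀ hs
  obtain ⟨-, -, hXs⟩ := X_pow_mem_planes κ₀ (ex44GA (K := K)) ex44H ex44GC ex44Q ex44P ex44_X_pow_mem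
  have hhil : ∀ b, finrank K (homogeneousSubmodule (Fin (2 * 5 + 2)) K b) -
      finrank K (idealDegree (annIdeal ℓ₁ ⊔ annIdeal ℓ₂) b) = ciHilbert (List.replicate 3 (3 - 1)) b := by
    intro b
    rw [hI₁, hI₂, planes_sup_eq_span]
    exact hilbert_span_twoPlanes_eq_ciHilbert hd κ₀ ex44GA ex44H ex44GC ex44P ex44_hgA ex44_hh ex44_hgC ex44_hP hXs b
  refine ⟨fun a' ha' => ?_, fun a' ha' => ?_, ?_⟩
  · exact excessSet_finite_of_colon hc₁ hc₂ (b := (5 + 1) * (3 - 2) - a') (by omega)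
      (colonCriterion_of_le hc₂ (by norm_num) ha' hP3)
  · refine excessSet_eq_empty_of_hilbert_eq_zero hc₁ hc₂ (b := (5 + 1) * (3 - 2) - a') (by omega) ?_
    rw [hhil]
    interval_cases a' <;> decide
  · calc (excessSet ℓ₁ ℓ₂ 3).ncard
        ≤ finrank K (homogeneousSubmodule (Fin (2 * 5 + 2)) K 3) - finrank K (idealDegree (annIdeal ℓ₁ ⊔ annIdeal ℓ₂) 3) :=
          ncard_excessSet_le_of_colon hc₁ hc₂ (b := 3) (by norm_num) hP3
      _ = ciHilbert (List.replicate 3 (3 - 1)) 3 := hhil 3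
      _ = 1 := by decide

end Example44

/-! ## Section 7 — Theorem 1.2 / Theorem 4.9: the two series of counterexamples, in every dimension

The `m`-fold cone of Example 4.3 (resp. 4.4) is a quartic (resp. cubic) hypersurface
`X̃ = V(f̃) ⊂ ℙ^{2k+1}`, `k = 3 + m` (resp. `k = 5 + m`), with finite-dimensional Jacobian ring (smooth), containing
the two `k`-planes `Π̃_j = V(plane_jGens)` meeting in codimension `c = 2` (resp. `3`); for EVERY socle functional `ℓ`
of `J^{f̃}` (Construction 3.1) and the two cycle functionals `ℓ_j = ℓ(·D̃_j)` (`I(ℓ_j) = I(Π̃_j)`, Example 3.5), the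
exceptional set `E_d(ℓ₁,ℓ₂) = {c ≠ 0 : (I(Π̃₁) ∩ I(Π̃₂))_d ⊊ I(ℓ₁ + cℓ₂)_d}` is finite with AT MOST ONE element, and
for every other `c ≠ 0` the degree-`d` parts agree. Through the dictionary of Lemmas 3.6/3.12 (not formalised here:
`I(ℓ₁+cℓ₂)_d ↔ T_X NL([Π₁]+λ[Π₂])`, `(I₁ ∩ I₂)_d ↔ T_X NL([Π₁],[Π₂])`, `c = ν(λ)`) this is Theorem 4.9:
"for almost all `λ ∈ ℚ` we have `codim T_X NL([Π₁]+λ[Π₂]) = codim T_X NL([Π₁],[Π₂])` … Moreover, if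
`(c−1)(d−2) = 2` then there is at most one nonzero `λ`" — and Theorem 1.2. -/

section Headline

open Literature.AlgebraicGeometry.Motives.UniversalHypersurface Literature.AlgebraicGeometry.Kloosterman2023

variable {K : Type*} [Field K] [CharZero K]

/-- **Theorem 4.9, `d = 4`, `c = 2`, every `k = 3 + m ≥ 3` (the quartic series).** For every socle functional `ℓ`
of the Jacobian ideal of the `m`-fold cone `f̃` of Example 4.3 and ANY indexing `κ` of the generators of the two
`k`-planes, the exceptional set of the pencil of the two cycle functionals in degree `d = 4` is finite and has at
most one element ("there is at most one nonzero `λ ∈ ℚ` such that `codim T_X NL([Π₁]+λ[Π₂]) ≠ codim T_X NL([Π₁],[Π₂])`").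
[cite: Kloosterman2025, Theorem 4.9, Theorem 1.2, Proposition 4.6, Proposition 4.7, Example 4.3] -/
theorem theorem_4_9_quartic (m : ℕ) (κ : Fin 2 ⊕ Fin (2 + m) ≃ Fin (3 + m + 1))
    {ℓ : MvPolynomial (Fin (2 * (3 + m) + 2)) K →ₗ[K] K}
    (hℓ : ∀ p, ℓ (homogeneousComponent ((2 * (3 + m) + 2) * (4 - 2)) p) = ℓ p)
    (hJ : annIdeal ℓ = jacobianIdeal (twoPlanesForm (coneGA m ex43GA) (coneGA m ex43H) (coneGC m ex43GC)
      (coneQ m ex43Q) (coneP m 4 ex43P))) :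
    (excessSet
        (ciCycleFunctional ℓ (plane₁Gens κ (coneGA m ex43GA) (coneGC m ex43GC))
          (plane₁Cofs κ (coneGA m ex43H) (coneQ m ex43Q) (coneP m 4 ex43P)))
        (ciCycleFunctional ℓ (plane₂Gens κ (coneGA m ex43H) (coneGC m ex43GC))
          (plane₂Cofs κ (coneGA m ex43GA) (coneQ m ex43Q) (coneP m 4 ex43P))) 4).Finite ∧
      (excessSet
        (ciCycleFunctional ℓ (plane₁Gens κ (coneGA m ex43GA) (coneGC m ex43GC))
          (plane₁Cofs κ (coneGA m ex43H) (coneQ m ex43Q) (coneP m 4 ex43P)))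
        (ciCycleFunctional ℓ (plane₂Gens κ (coneGA m ex43H) (coneGC m ex43GC))
          (plane₂Cofs κ (coneGA m ex43GA) (coneQ m ex43Q) (coneP m 4 ex43P))) 4).ncard ≤ 1 := by
  obtain ⟨ℓ₀, hℓ₀, -, hJ₀⟩ := exists_annIdeal_eq_jacobianIdeal_twoPlanesForm (by norm_num) (ex43GA (K := K)) ex43H
    ex43GC ex43Q ex43P ex43_hgA ex43_hh ex43_hgC ex43_hQ ex43_hP (by norm_num : 0 < 9) ex43_X_pow_mem
  set κ₀ : Fin 2 ⊕ Fin 2 ≃ Fin (3 + 1) := finSumFinEquiv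
  obtain ⟨hfin, hempty, hle⟩ := ex43_base κ₀ hℓ₀ hJ₀
  have H := excessSet_cone (κ₀ := κ₀) (κ := κ) (by norm_num : 3 ≤ 4) ex43_hgA ex43_hh ex43_hgC ex43_hQ
    ex43_hP (by norm_num : 0 < 9) ex43_X_pow_mem hℓ₀ hJ₀ hℓ hJ 4
  exact ⟨H.1 hfin, (H.2 hempty (hfin 4 le_rfl)).trans hle⟩

/-- **Non-vacuity of `theorem_4_9_quartic`**: the `m`-fold cone of Example 4.3 is smooth (`x_l^N ∈ J^{f̃}` for all
`2k+2` variables: "For a general cone … singular, but in our case … `X = V(f)` is smooth") and `J^{f̃}` HAS a socle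
functional in degree `(2k+2)(d−2)` (Construction 3.1 / Remark 3.2). [cite: Kloosterman2025, Theorem 4.9 (proof),
Construction 3.1] -/
theorem theorem_4_9_quartic_nonvacuous (m : ℕ) :
    (∃ N, 0 < N ∧ ∀ l, (X l : MvPolynomial (Fin (2 * (3 + m) + 2)) K) ^ N ∈
        jacobianIdeal (twoPlanesForm (coneGA m ex43GA) (coneGA m ex43H) (coneGC m ex43GC) (coneQ m ex43Q)
          (coneP m 4 ex43P))) ∧
      ∃ ℓ : MvPolynomial (Fin (2 * (3 + m) + 2)) K →ₗ[K] K,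
        (∀ p, ℓ (homogeneousComponent ((2 * (3 + m) + 2) * (4 - 2)) p) = ℓ p) ∧ ℓ ≠ 0 ∧
          annIdeal ℓ = jacobianIdeal (twoPlanesForm (coneGA m ex43GA) (coneGA m ex43H) (coneGC m ex43GC) (coneQ m ex43Q)
            (coneP m 4 ex43P)) := by
  obtain ⟨N, hN, hXN⟩ := exists_X_pow_mem_jacobianIdeal_cone m 4 (ex43GA (K := K)) ex43H ex43GC ex43Q ex43P
    (by norm_num) (by norm_num : 0 < 9) ex43_X_pow_mem
  exact ⟨⟨N, hN, hXN⟩, exists_annIdeal_eq_jacobianIdeal_twoPlanesForm (by norm_num) _ _ _ _ _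
    (isHomogeneous_coneGA ex43_hgA) (isHomogeneous_coneGA ex43_hh) (isHomogeneous_coneGC ex43_hgC)
    (isHomogeneous_coneQ ex43_hQ) (isHomogeneous_coneP ex43_hP) hN hXN⟩

/-- **Theorem 4.9, `d = 4`, `c = 2`, `k = 3 + m`, as printed**: there is a finite set `E ⊂ K` with at most one
element such that for every `c ∉ E`, `c ≠ 0`, the degree-`4` part of the Gorenstein ideal of the pencil member
`ℓ₁ + cℓ₂` equals `(I(Π̃₁) ∩ I(Π̃₂))_4` ("for almost all `λ ∈ ℚ` we have `codim T_X NL([Π₁]+λ[Π₂]) =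
codim T_X NL([Π₁],[Π₂])`, in particular `NL([Π₁]+λ[Π₂]) = NL([Π₁],[Π₂])` in a neighborhood of `X` … at most one
nonzero `λ`"). [cite: Kloosterman2025, Theorem 4.9, Theorem 1.2] -/
theorem theorem_4_9_quartic_almost_all (m : ℕ) (κ : Fin 2 ⊕ Fin (2 + m) ≃ Fin (3 + m + 1))
    {ℓ : MvPolynomial (Fin (2 * (3 + m) + 2)) K →ₗ[K] K}
    (hℓ : ∀ p, ℓ (homogeneousComponent ((2 * (3 + m) + 2) * (4 - 2)) p) = ℓ p)
    (hJ : annIdeal ℓ = jacobianIdeal (twoPlanesForm (coneGA m ex43GA) (coneGA m ex43H) (coneGC m ex43GC)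
      (coneQ m ex43Q) (coneP m 4 ex43P))) :
    ∃ E : Set K, E.Finite ∧ E.ncard ≤ 1 ∧ ∀ c : K, c ≠ 0 → c ∉ E →
      idealDegree (annIdeal
          (ciCycleFunctional ℓ (plane₁Gens κ (coneGA m ex43GA) (coneGC m ex43GC))
              (plane₁Cofs κ (coneGA m ex43H) (coneQ m ex43Q) (coneP m 4 ex43P)) +
            c • ciCycleFunctional ℓ (plane₂Gens κ (coneGA m ex43H) (coneGC m ex43GC))
              (plane₂Cofs κ (coneGA m ex43GA) (coneQ m ex43Q) (coneP m 4 ex43P)))) 4 =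
        idealDegree
          (annIdeal (ciCycleFunctional ℓ (plane₁Gens κ (coneGA m ex43GA) (coneGC m ex43GC))
              (plane₁Cofs κ (coneGA m ex43H) (coneQ m ex43Q) (coneP m 4 ex43P))) ⊓
            annIdeal (ciCycleFunctional ℓ (plane₂Gens κ (coneGA m ex43H) (coneGC m ex43GC))
              (plane₂Cofs κ (coneGA m ex43GA) (coneQ m ex43Q) (coneP m 4 ex43P)))) 4 :=
  ⟨_, (theorem_4_9_quartic m κ hℓ hJ).1, (theorem_4_9_quartic m κ hℓ hJ).2, fun _ hc0 hc =>
    idealDegree_annIdeal_add_smul_eq_of_notMem_excessSet hc0 hc⟩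

/-- **Theorem 1.2 for `d = 4`, `c = 2`: a counterexample to Movasati's conjecture in `ℙ^{2k+1}` for EVERY `k ≥ 3`.**
For every `k ≥ 3` there are data `(gA, h, gC, Q, P)` of Kloosterman's normal form (linear forms `gA, h` (`c = 2`
each), `gC` (`r = k − 1`), `Q` of degree `2`, `P` of degree `3`) — a quartic `X = V(F) ⊂ ℙ^{2k+1}`,
`F = twoPlanesForm gA h gC Q P`, containing the `k`-planes `Π₁ = V(gA,gC)`, `Π₂ = V(h,gC)` meeting in codimension
`2` (formally: the `2·2 + r = (k+1) + 2` linear forms `gA, h, gC` are linearly independent) — with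
finite-dimensional Jacobian ring (smooth), such that for every socle functional of `J^F` the exceptional set of the
two cycle functionals in degree `4` is finite with at most one element. [cite: Kloosterman2025, Theorem 1.2,
Theorem 4.9] -/
theorem theorem_1_2_quartic (k : ℕ) (hk : 3 ≤ k) :
    ∃ (r : ℕ) (κ : Fin 2 ⊕ Fin r ≃ Fin (k + 1)) (gA h : Fin 2 → MvPolynomial (Fin (2 * k + 2)) K)
      (gC : Fin r → MvPolynomial (Fin (2 * k + 2)) K) (Q : Fin 2 → Fin 2 → MvPolynomial (Fin (2 * k + 2)) K)
      (P : Fin r → MvPolynomial (Fin (2 * k + 2)) K),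
      LinearIndependent K (Sum.elim (Sum.elim gA h) gC) ∧
      (∀ i, (gA i).IsHomogeneous 1) ∧ (∀ j, (h j).IsHomogeneous 1) ∧ (∀ l, (gC l).IsHomogeneous 1) ∧
      (∀ i j, (Q i j).IsHomogeneous (4 - 2)) ∧ (∀ l, (P l).IsHomogeneous (4 - 1)) ∧
      (∃ N, 0 < N ∧ ∀ l, (X l : MvPolynomial (Fin (2 * k + 2)) K) ^ N ∈ jacobianIdeal (twoPlanesForm gA h gC Q P)) ∧
      (∃ ℓ : MvPolynomial (Fin (2 * k + 2)) K →ₗ[K] K,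
        (∀ p, ℓ (homogeneousComponent ((2 * k + 2) * (4 - 2)) p) = ℓ p) ∧ ℓ ≠ 0 ∧
          annIdeal ℓ = jacobianIdeal (twoPlanesForm gA h gC Q P)) ∧
      ∀ ℓ : MvPolynomial (Fin (2 * k + 2)) K →ₗ[K] K,
        (∀ p, ℓ (homogeneousComponent ((2 * k + 2) * (4 - 2)) p) = ℓ p) →
        annIdeal ℓ = jacobianIdeal (twoPlanesForm gA h gC Q P) →
        (excessSet (ciCycleFunctional ℓ (plane₁Gens κ gA gC) (plane₁Cofs κ h Q P))
            (ciCycleFunctional ℓ (plane₂Gens κ h gC) (plane₂Cofs κ gA Q P)) 4).Finite ∧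
        (excessSet (ciCycleFunctional ℓ (plane₁Gens κ gA gC) (plane₁Cofs κ h Q P))
            (ciCycleFunctional ℓ (plane₂Gens κ h gC) (plane₂Cofs κ gA Q P)) 4).ncard ≤ 1 := by
  obtain ⟨m, rfl⟩ : ∃ m, k = 3 + m := ⟨k - 3, by omega⟩
  exact ⟨2 + m, finSumFinEquiv.trans (finCongr (by omega)), coneGA m ex43GA, coneGA m ex43H, coneGC m ex43GC,
    coneQ m ex43Q, coneP m 4 ex43P, linearIndependent_cone m ex43_planes_linearIndependent,
    isHomogeneous_coneGA ex43_hgA, isHomogeneous_coneGA ex43_hh,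
    isHomogeneous_coneGC ex43_hgC, isHomogeneous_coneQ ex43_hQ, isHomogeneous_coneP ex43_hP,
    (theorem_4_9_quartic_nonvacuous m).1, (theorem_4_9_quartic_nonvacuous m).2,
    fun ℓ hℓ hJ => theorem_4_9_quartic m _ hℓ hJ⟩

/-- **Theorem 4.9, `d = 3`, `c = 3`, every `k = 5 + m ≥ 5` (the cubic series of Example 4.4).**
[cite: Kloosterman2025, Theorem 4.9, Theorem 1.2, Proposition 4.6, Proposition 4.7, Example 4.4] -/
theorem theorem_4_9_cubic (m : ℕ) (κ : Fin 3 ⊕ Fin (3 + m) ≃ Fin (5 + m + 1))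
    {ℓ : MvPolynomial (Fin (2 * (5 + m) + 2)) K →ₗ[K] K}
    (hℓ : ∀ p, ℓ (homogeneousComponent ((2 * (5 + m) + 2) * (3 - 2)) p) = ℓ p)
    (hJ : annIdeal ℓ = jacobianIdeal (twoPlanesForm (coneGA m ex44GA) (coneGA m ex44H) (coneGC m ex44GC)
      (coneQ m ex44Q) (coneP m 3 ex44P))) :
    (excessSet
        (ciCycleFunctional ℓ (plane₁Gens κ (coneGA m ex44GA) (coneGC m ex44GC))
          (plane₁Cofs κ (coneGA m ex44H) (coneQ m ex44Q) (coneP m 3 ex44P)))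
        (ciCycleFunctional ℓ (plane₂Gens κ (coneGA m ex44H) (coneGC m ex44GC))
          (plane₂Cofs κ (coneGA m ex44GA) (coneQ m ex44Q) (coneP m 3 ex44P))) 3).Finite ∧
      (excessSet
        (ciCycleFunctional ℓ (plane₁Gens κ (coneGA m ex44GA) (coneGC m ex44GC))
          (plane₁Cofs κ (coneGA m ex44H) (coneQ m ex44Q) (coneP m 3 ex44P)))
        (ciCycleFunctional ℓ (plane₂Gens κ (coneGA m ex44H) (coneGC m ex44GC))
          (plane₂Cofs κ (coneGA m ex44GA) (coneQ m ex44Q) (coneP m 3 ex44P))) 3).ncard ≤ 1 := by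
  obtain ⟨ℓ₀, hℓ₀, -, hJ₀⟩ := exists_annIdeal_eq_jacobianIdeal_twoPlanesForm (by norm_num) (ex44GA (K := K)) ex44H
    ex44GC ex44Q ex44P ex44_hgA ex44_hh ex44_hgC ex44_hQ ex44_hP (by norm_num : 0 < 5) ex44_X_pow_mem
  set κ₀ : Fin 3 ⊕ Fin 3 ≃ Fin (5 + 1) := finSumFinEquiv
  obtain ⟨hfin, hempty, hle⟩ := ex44_base κ₀ hℓ₀ hJ₀
  have H := excessSet_cone (κ₀ := κ₀) (κ := κ) (le_refl 3) ex44_hgA ex44_hh ex44_hgC ex44_hQ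
    ex44_hP (by norm_num : 0 < 5) ex44_X_pow_mem hℓ₀ hJ₀ hℓ hJ 3
  exact ⟨H.1 hfin, (H.2 hempty (hfin 3 le_rfl)).trans hle⟩

/-- **Non-vacuity of `theorem_4_9_cubic`**: smoothness of the cone and existence of a socle functional.
[cite: Kloosterman2025, Theorem 4.9 (proof), Construction 3.1] -/
theorem theorem_4_9_cubic_nonvacuous (m : ℕ) :
    (∃ N, 0 < N ∧ ∀ l, (X l : MvPolynomial (Fin (2 * (5 + m) + 2)) K) ^ N ∈
        jacobianIdeal (twoPlanesForm (coneGA m ex44GA) (coneGA m ex44H) (coneGC m ex44GC) (coneQ m ex44Q)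
          (coneP m 3 ex44P))) ∧
      ∃ ℓ : MvPolynomial (Fin (2 * (5 + m) + 2)) K →ₗ[K] K,
        (∀ p, ℓ (homogeneousComponent ((2 * (5 + m) + 2) * (3 - 2)) p) = ℓ p) ∧ ℓ ≠ 0 ∧
          annIdeal ℓ = jacobianIdeal (twoPlanesForm (coneGA m ex44GA) (coneGA m ex44H) (coneGC m ex44GC) (coneQ m ex44Q)
            (coneP m 3 ex44P)) := by
  obtain ⟨N, hN, hXN⟩ := exists_X_pow_mem_jacobianIdeal_cone m 3 (ex44GA (K := K)) ex44H ex44GC ex44Q ex44P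
    (le_refl 3) (by norm_num : 0 < 5) ex44_X_pow_mem
  exact ⟨⟨N, hN, hXN⟩, exists_annIdeal_eq_jacobianIdeal_twoPlanesForm (by norm_num) _ _ _ _ _
    (isHomogeneous_coneGA ex44_hgA) (isHomogeneous_coneGA ex44_hh) (isHomogeneous_coneGC ex44_hgC)
    (isHomogeneous_coneQ ex44_hQ) (isHomogeneous_coneP ex44_hP) hN hXN⟩

/-- **Theorem 4.9, `d = 3`, `c = 3`, `k = 5 + m`, as printed** (almost all `c`, at most one exception).
[cite: Kloosterman2025, Theorem 4.9, Theorem 1.2] -/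
theorem theorem_4_9_cubic_almost_all (m : ℕ) (κ : Fin 3 ⊕ Fin (3 + m) ≃ Fin (5 + m + 1))
    {ℓ : MvPolynomial (Fin (2 * (5 + m) + 2)) K →ₗ[K] K}
    (hℓ : ∀ p, ℓ (homogeneousComponent ((2 * (5 + m) + 2) * (3 - 2)) p) = ℓ p)
    (hJ : annIdeal ℓ = jacobianIdeal (twoPlanesForm (coneGA m ex44GA) (coneGA m ex44H) (coneGC m ex44GC)
      (coneQ m ex44Q) (coneP m 3 ex44P))) :
    ∃ E : Set K, E.Finite ∧ E.ncard ≤ 1 ∧ ∀ c : K, c ≠ 0 → c ∉ E →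
      idealDegree (annIdeal
          (ciCycleFunctional ℓ (plane₁Gens κ (coneGA m ex44GA) (coneGC m ex44GC))
              (plane₁Cofs κ (coneGA m ex44H) (coneQ m ex44Q) (coneP m 3 ex44P)) +
            c • ciCycleFunctional ℓ (plane₂Gens κ (coneGA m ex44H) (coneGC m ex44GC))
              (plane₂Cofs κ (coneGA m ex44GA) (coneQ m ex44Q) (coneP m 3 ex44P)))) 3 =
        idealDegree
          (annIdeal (ciCycleFunctional ℓ (plane₁Gens κ (coneGA m ex44GA) (coneGC m ex44GC))
              (plane₁Cofs κ (coneGA m ex44H) (coneQ m ex44Q) (coneP m 3 ex44P))) ⊓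
            annIdeal (ciCycleFunctional ℓ (plane₂Gens κ (coneGA m ex44H) (coneGC m ex44GC))
              (plane₂Cofs κ (coneGA m ex44GA) (coneQ m ex44Q) (coneP m 3 ex44P)))) 3 :=
  ⟨_, (theorem_4_9_cubic m κ hℓ hJ).1, (theorem_4_9_cubic m κ hℓ hJ).2, fun _ hc0 hc =>
    idealDegree_annIdeal_add_smul_eq_of_notMem_excessSet hc0 hc⟩

/-- **Theorem 1.2 for `d = 3`, `c = 3`: a counterexample to Movasati's conjecture for cubics in `ℙ^{2k+1}`, every
`k ≥ 5`** (the clause `LinearIndependent K (gA, h, gC)` — `2·3 + r = (k+1) + 3` independent linear forms — says that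
`Π₁ = V(gA,gC)`, `Π₂ = V(h,gC)` are two `k`-planes meeting in codimension `3`). [cite: Kloosterman2025, Theorem 1.2,
Theorem 4.9] -/
theorem theorem_1_2_cubic (k : ℕ) (hk : 5 ≤ k) :
    ∃ (r : ℕ) (κ : Fin 3 ⊕ Fin r ≃ Fin (k + 1)) (gA h : Fin 3 → MvPolynomial (Fin (2 * k + 2)) K)
      (gC : Fin r → MvPolynomial (Fin (2 * k + 2)) K) (Q : Fin 3 → Fin 3 → MvPolynomial (Fin (2 * k + 2)) K)
      (P : Fin r → MvPolynomial (Fin (2 * k + 2)) K),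
      LinearIndependent K (Sum.elim (Sum.elim gA h) gC) ∧
      (∀ i, (gA i).IsHomogeneous 1) ∧ (∀ j, (h j).IsHomogeneous 1) ∧ (∀ l, (gC l).IsHomogeneous 1) ∧
      (∀ i j, (Q i j).IsHomogeneous (3 - 2)) ∧ (∀ l, (P l).IsHomogeneous (3 - 1)) ∧
      (∃ N, 0 < N ∧ ∀ l, (X l : MvPolynomial (Fin (2 * k + 2)) K) ^ N ∈ jacobianIdeal (twoPlanesForm gA h gC Q P)) ∧
      (∃ ℓ : MvPolynomial (Fin (2 * k + 2)) K →ₗ[K] K,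
        (∀ p, ℓ (homogeneousComponent ((2 * k + 2) * (3 - 2)) p) = ℓ p) ∧ ℓ ≠ 0 ∧
          annIdeal ℓ = jacobianIdeal (twoPlanesForm gA h gC Q P)) ∧
      ∀ ℓ : MvPolynomial (Fin (2 * k + 2)) K →ₗ[K] K,
        (∀ p, ℓ (homogeneousComponent ((2 * k + 2) * (3 - 2)) p) = ℓ p) →
        annIdeal ℓ = jacobianIdeal (twoPlanesForm gA h gC Q P) →
        (excessSet (ciCycleFunctional ℓ (plane₁Gens κ gA gC) (plane₁Cofs κ h Q P))
            (ciCycleFunctional ℓ (plane₂Gens κ h gC) (plane₂Cofs κ gA Q P)) 3).Finite ∧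
        (excessSet (ciCycleFunctional ℓ (plane₁Gens κ gA gC) (plane₁Cofs κ h Q P))
            (ciCycleFunctional ℓ (plane₂Gens κ h gC) (plane₂Cofs κ gA Q P)) 3).ncard ≤ 1 := by
  obtain ⟨m, rfl⟩ : ∃ m, k = 5 + m := ⟨k - 5, by omega⟩
  exact ⟨3 + m, finSumFinEquiv.trans (finCongr (by omega)), coneGA m ex44GA, coneGA m ex44H, coneGC m ex44GC,
    coneQ m ex44Q, coneP m 3 ex44P, linearIndependent_cone m ex44_planes_linearIndependent,
    isHomogeneous_coneGA ex44_hgA, isHomogeneous_coneGA ex44_hh,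
    isHomogeneous_coneGC ex44_hgC, isHomogeneous_coneQ ex44_hQ, isHomogeneous_coneP ex44_hP,
    (theorem_4_9_cubic_nonvacuous m).1, (theorem_4_9_cubic_nonvacuous m).2,
    fun ℓ hℓ hJ => theorem_4_9_cubic m _ hℓ hJ⟩

end Headline

end Literature.AlgebraicGeometry.Kloosterman2025

end
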